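import Summits.HodgeConjecture.HodgeConjecture.Cruxes.BlochSeedDiscOne.FinCheck
import Summits.HodgeConjecture.HodgeConjecture.Cruxes.BlochSeedDiscOne.B4FloorSymmetry

/-!
# CoverIntegrality — the cell-cover INTEGRALITY LAW family of node R19.515 «CIL» (v2.4: TYPED STATEMENTS; L1 ∕ L2 ∕ L1⁺ + SHADOW ROWS KERNEL-SOUND; §6 SYMMETRY LEMMA + §6.2 TORUS ∕ §6.3 FLIP SYMMETRISATION KERNEL; §7 LEVEL 1.5: ORBIT-SUMMED |E| = 1 ROWS ON LETTER MARGINALS + PER-LETTER COVER LAW, KERNEL-SOUND)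

Typist: plan-lens-HodgeAV-strengthen g11 ∕ g12 (single writer of this file; R19.515 (1); v2.3 = director-hodge R19.527 (1) TYPIST ORDER (a)(b); v2.4 = + §6.3 flip symmetrisation, negation g18 l.10516 LEMMA (1)). Pen of the joint statement:
`Cruxes/BlochSeedDiscOne/COVER-INTEGRALITY-JOINT.md` (negation g17; §A s4-search-1 g33, §B negation g17, §C gs-eng-2 g61); keep∕kill officer idea-crit-6.
Token: `line stmt-HodgeConjecture-18881 Cruxes/BlochSeedDiscOne/Lines/birth.lean 814a6a70c14e831a stub_rung_pad4_seedAt`.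

HONEST FRAMING. Everything here is about the LETTER model `DepthBoundA4` (cells = ordered 4-tuples of letters, designs = two lists of
(cell, multiplicity)) in the design language of `FinCheck` (`Design ∕ A1 ∕ A4 ∕ copies ∕ rank ∕ OnAlphabet ∕ SuppIn ∕ mN ∕ mP`, and the FUNCTION FORM
`A1fun ∕ A4fun ∕ copiesfun ∕ rankfun ∕ NoFloor` on a finite cell set `U`). A typed `Prop`, a theorem about supports of (A4) designs, a no-good row ≠ a floor ≠
designs ≠ sheaves ≠ a SEED. NOTHING here proves `FloorFree 6 199 8`, `IntegralityGap.Nonex 14 199 8`, 18881 (`BlochSeedDiscOne`), H2, HC_AV, HC_CM or HC;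
no storey of `FloorFree` is closed.

CONTENTS (v1).
* §1 **L1 COVER CLOSURE** (joint memo B.2): `CoverClosed SN SP` (support form), `CoverRows D S` (MASS FORM, threshold `1`), `CoverRowsFun U gN gP`
  (function form) — with the KERNEL soundness `coverClosed_of_A4`, `coverRows_of_A4` ((A4) + «a positive natural number is `≥ 1`»; no (A1), no budget)
  and `coverRowsFun_iff_A4fun` (the rows ARE (A4) in function form), plus the BRANCHING reading `coverRow_branch` («`gN y = 0 ∨ Σ_{c ⊲ y} gP c ≥ 1`»).
* §2 **L2 CLOSURE FIXPOINT** (B.2): the pruning operator `prune` on support pairs, `prune^[k]` = the `k`-round core, and the KERNEL soundness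
  `supp_subset_iterate_prune` (an (A4) design supported in `(A, B)` is supported in every `prune^[k] (A, B)`); graded family `CIL k` (all TRUE: `cil_holds`).
* §3 **L1⁺ COVER COUNT at `h = 6`** (B.3): the letter facts (F1) «amply below a height-2 letter ⇒ height 0» and (F2) «a floor letter is amply below at most
  one height-2 letter» as kernel `decide`s over the height-6 letter box, and the LAW `CoverCountLaw6` («#{distinct bottom⁴ N cells} ≤ Σ_{floor⁴ P cells} m_P»)
  with its KERNEL proof `coverCountLaw6_holds` (§3.1, v1.1: the injection `y ↦ cover(y)` from F1∕F2, `Finset.card_le_card_of_injOn`) + its function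
  form `CoverCountRowFun ∕ coverCountLawFun6_holds` and the bundle `live_bottom4_card_le_14` (with `FinCheck.rows_fun`: ≤ 14 live bottom⁴ N cells at `(6, 199)`).
* §4 **L0 SUPPORT NO-GOOD ROW** (A.3 ∕ R19.517 (1)): `SupportNoGoodRow U T B rmin R` — «every (A1) ∧ (A4) assignment on `U` with copies `≤ B`, rank `≥ rmin`,
  a floor letter, and the region constraint `R` puts mass `≥ 1` OUTSIDE `T`». ANSWER TO «can L0 be a row?»: YES, as this NO-GOOD (cover) CUT — ONE row per
  (region, support `T`), sound exactly when the support is integer-empty (what the lattice probe ×2 reports for the 13 lowest phantom supports; kernel replay =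
  a bounded ℤ-lattice emptiness certificate per support, not typed here); it is NOT one support-independent row, and «support marginal integrality» itself
  (the shape-count vector of a design is an INTEGER point) is not a linear row at all — in `rows_fun` letter it is the typing `gN gP : Cell → ℕ`.
* §1.4 (v2.1) the SHADOWS `ShapeBelow` ∕ `TypeBelow` (⊲_T) ∕ `MultisetBelow` (⊲_S) of B.2 and `shadowRows_of_A4fun`: the cover rows over ANY
  relation `R ⊇ Live` hold at every (A4) assignment (kernel soundness of type∕shape-level cover rows and of the KILL-TEST branch pair `shadow_branch`).
* §6 (v2) the SYMMETRY LEMMA of the joint memo (B.1) in kernel form: `rowSum_eq_zero_of_symmetric`, `symmetricPoint_Tfun_eq_zero`,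
  `symmetricPoint_mu_eq_zero` («the symmetric point has μ = 0»), `turnClosed_cellsOn`, over `B4FloorSymmetry.rotAt ∕ rotUnit ∕ cellCoef_rotAt`.
* §6.2 (v2.2) TORUS SYMMETRISATION (the «(≥)» half of B.1 for integer points): `torusSum`, `torusSum_rotCell`, `sum_torusSum_mul` (× 256),
  `Tfun_torusSum_efree`, `copiesfun_torusSum`, `rankfun_torusSum`, `A4fun_torusSum`, `noFloor_torusSum_iff`, `A1fun_torusSum`, `torus_symmetrisation`.
* §6.3 (v2.4) **FLIP SYMMETRISATION** (negation g18 LEMMA (1), bus l.10516): the `{±1}⁴ = {0,2}⁴` subgroup of the torus — `dbl`, `flipSum g c =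
  Σ_{s : Fin 4 → Bool} g (rotCell (dbl s) c)`, `flipChar w = Σ_s ρ(w, dbl s) = ∏_f (phase(w_f)² + 1)` (`flipChar_eq_prod`; `= 16` on e-free words,
  `= 0` on every word with an `e`∕`ē` slot), `Tfun_flipSum : Tfun U (flipSum gN) (flipSum gP) w = flipChar w * Tfun U gN gP w` on torus-closed `U`,
  hence `Tfun_flipSum_not_efree` (ALL e-charged rows incl. `μ` vanish), `Tfun_flipSum_efree` (× 16), `copiesfun_flipSum` ∕ `rankfun_flipSum` (× 16),
  `A4fun_flipSum`, `noFloor_flipSum_iff`, `A1fun_flipSum`; packaged as **`flip_symmetrisation h gN gP`** (8 conjuncts, factor 16 in place of §6.2's 256).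
* §7 (v2.3, R19.527 (1)) **LEVEL 1.5 KERNEL SOUNDNESS** — the two sentences CIBB-1.5's PREREG (gs-eng-2) and Δ3 (dual) cite:
  (a) ORBIT-SUMMED |E| = 1 ROWS: `eWord f ψ` (one `e` at the active slot, e-free passive filling), `orbitRowE1` (sum over the 4 active slots ×
  the 6 placements of the filling = the S₄-orbit sum), `orbitRowE1_eq_zero` (VALID AT EVERY (A1) ASSIGNMENT — each summand is an (A1).1 row; NO
  symmetry of the assignment assumed), `cellCoef_eWord` ∕ `orbitRowE1_eq_incidence` (the coefficient of an incidence (cell, active slot) is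
  `conj β(active letter) · V3 φ (passive letters)`), `V3_congr_prof` ∕ `V3_perm` (`V3` is a SYMMETRIC function of the passive PROFILES `(a, n)`),
  `key` ∕ `marg` ∕ `keyCoef` ∕ `orbitRowE1_eq_marginal` ∕ **`orbitRowE1_marginal_sound`** (the row written on the LETTER MARGINALS `y[τ,σ,ℓ]` =
  incidence counts by (multiset type, active letter), coefficient `conj β(ℓ) · V3 φ (τ ∖ σ)`, vanishes at every (A1) assignment);
  (b) PER-LETTER COVER LAW = L1 at level 1.5: `letterCoverRows_of_A4fun` (generic: any key map, any relation shadowing `Live` slot by slot),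
  **`coverRowsLetter_of_A4fun`** («`y_N[τ,σ,ℓ] ≥ 1 ⇒ Σ_{ℓ' amply below ℓ} y_P ≥ 1`» and dually), `coverRowsLetterCov_of_A4fun` (the (Dy) rows
  with `π ∈ Cov(τ)` exactly), **`coverClosedLetter_of_A4`** (support form beside `coverClosed_of_A4`); bookkeeping `exists_perm_of_map_univ_eq`
  (tuples with equal value multisets differ by a placement) makes the multiset keys honest. (A4) + integrality only for (b); (A1).1 only for (a).
* §5 the UMBRELLA `CoverIntegralityLaw := CoverClosureLaw ∧ ClosureFixpointLaw ∧ CoverCountLaw6` — a THEOREM since v1.1 (`coverIntegralityLaw_holds`):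
  the v1 laws L1 ∕ L2 ∕ L1⁺ are all consequences of (A4) + integrality (+ the h = 6 letter facts); what they add to an LP is exactly what the LP
  relaxation loses (joint memo B.1 SYMMETRY LEMMA), not new axioms.
NOT IN v1 (v2 if the officer keeps the laws): the SHAPE ∕ TYPE shadows `⊲_S`, `⊲_T` of B.2 (needed only for the kernel to replay s4's shape-level KILL-TESTs),
and LEVEL 1.5's per-slot letter-count system (§C) as a `Prop`.
-/

set_option linter.dupNamespace false
set_option autoImplicit false

namespace Summit.HodgeConjecture.HodgeConjecture.Cruxes.BlochSeedDiscOne.CoverIntegrality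

open Summit.HodgeConjecture.HodgeConjecture.Cruxes.BlochSeedDiscOne.DepthBoundA4
open Summit.HodgeConjecture.HodgeConjecture.Cruxes.BlochSeedDiscOne.HeightTower
open Summit.HodgeConjecture.HodgeConjecture.Cruxes.BlochSeedDiscOne.FinCheck

/-! ## §0 Two arithmetic helpers («present ⇒ mass ≥ 1») -/

theorem one_le_sum_of_mem_pos {S : Finset Cell} {g : Cell → ℕ} {a : Cell} (ha : a ∈ S) (hpos : 0 < g a) :
    1 ≤ ∑ c ∈ S, g c :=
  le_trans (Nat.succ_le_of_lt hpos) (Finset.single_le_sum (fun c _ => Nat.zero_le (g c)) ha)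

theorem exists_pos_of_one_le_sum {S : Finset Cell} {g : Cell → ℕ} (h : 1 ≤ ∑ c ∈ S, g c) : ∃ a ∈ S, 0 < g a := by
  obtain ⟨a, ha, hne⟩ := Finset.exists_ne_zero_of_sum_ne_zero (show ∑ c ∈ S, g c ≠ 0 by omega)
  exact ⟨a, ha, Nat.pos_of_ne_zero hne⟩

/-! ## §1 L1 — COVER CLOSURE (joint memo B.2): (A4) on SUPPORTS, threshold 1 -/

/-- «the P cell `c` lies slotwise amply below the N cell `y`» — this is `Live c y` of `DepthBoundA4` (the pen's `c ⊲ y`); recorded as an alias. -/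
abbrev Below (c y : Cell) : Prop := Live c y

/-- **L1, support form.** A support pair `(SN, SP)` is COVER-CLOSED: every N cell has a covering P cell and every P cell a co-covering N cell. -/
def CoverClosed (SN SP : Finset Cell) : Prop :=
  (∀ y ∈ SN, ∃ c ∈ SP, Live c y) ∧ (∀ c ∈ SP, ∃ y ∈ SN, Live c y)

/-- **L1 as a law on designs:** the support pair of every (A4) design is cover-closed. -/
def CoverClosureLaw : Prop := ∀ D : Design, D.A4 → CoverClosed D.suppN.toFinset D.suppP.toFinset

/-- SOUNDNESS of L1 (support form): this IS (A4) read with «present = positive multiplicity». -/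
theorem coverClosed_of_A4 {D : Design} (h4 : D.A4) : CoverClosed D.suppN.toFinset D.suppP.toFinset := by
  refine ⟨fun y hy => ?_, fun c hc => ?_⟩
  · obtain ⟨x, hx, hl⟩ := h4.2 y (List.mem_toFinset.mp hy)
    exact ⟨x, List.mem_toFinset.mpr hx, hl⟩
  · obtain ⟨y, hy, hl⟩ := h4.1 c (List.mem_toFinset.mp hc)
    exact ⟨y, List.mem_toFinset.mpr hy, hl⟩

theorem coverClosureLaw_holds : CoverClosureLaw := fun _ h4 => coverClosed_of_A4 h4

/-- **L1, MASS FORM (threshold 1)** on a cell set `S` carrying the design: for every present N cell `y`, the P cells of `S` below `y` have total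
multiplicity `≥ 1`; for every present P cell `c`, the N cells of `S` above `c` have total multiplicity `≥ 1`. (An LP can only carry the big-M
shadow `m_N(y) ≤ B · Σ_{c ⊲ y} m_P(c)`; the law's real form is the disjunction `m_N(y) = 0 ∨ Σ ≥ 1`, `coverRow_branch`.) -/
def CoverRows (D : Design) (S : Finset Cell) : Prop :=
  (∀ c ∈ S, 0 < D.mP c → 1 ≤ ∑ y ∈ S.filter (fun y => Live c y), D.mN y) ∧
  (∀ y ∈ S, 0 < D.mN y → 1 ≤ ∑ c ∈ S.filter (fun c => Live c y), D.mP c)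

/-- SOUNDNESS of L1 (mass form): (A4) + integrality of multiplicities; no (A1), no budget. -/
theorem coverRows_of_A4 {D : Design} (h4 : D.A4) {S : Finset Cell} (hS : SuppIn D S) : CoverRows D S := by
  refine ⟨fun c _ hc => ?_, fun y _ hy => ?_⟩
  · obtain ⟨y, hy, hl⟩ := h4.1 c ((mem_suppP_iff_pos D c).mpr hc)
    exact one_le_sum_of_mem_pos (Finset.mem_filter.mpr ⟨hS y (List.mem_append_left _ hy), hl⟩)
      ((mem_suppN_iff_pos D y).mp hy)
  · obtain ⟨x, hx, hl⟩ := h4.2 y ((mem_suppN_iff_pos D y).mpr hy)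
    exact one_le_sum_of_mem_pos (Finset.mem_filter.mpr ⟨hS x (List.mem_append_right _ hx), hl⟩)
      ((mem_suppP_iff_pos D x).mp hx)

/-- **L1, FUNCTION FORM** on a finite cell set `U` (the `rows_fun` letter): the two families of threshold-1 cover rows. -/
def CoverRowsFun (U : Finset Cell) (gN gP : Cell → ℕ) : Prop :=
  (∀ x ∈ U, 0 < gP x → 1 ≤ ∑ y ∈ U.filter (fun y => Live x y), gN y) ∧
  (∀ y ∈ U, 0 < gN y → 1 ≤ ∑ x ∈ U.filter (fun x => Live x y), gP x)

/-- the cover rows ARE (A4) in function form (so `FinCheckOn U B rmin` may carry them in place of `A4fun`). -/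
theorem coverRowsFun_iff_A4fun (U : Finset Cell) (gN gP : Cell → ℕ) : CoverRowsFun U gN gP ↔ A4fun U gN gP := by
  constructor
  · rintro ⟨hP, hN⟩
    refine ⟨fun x hx hpos => ?_, fun y hy hpos => ?_⟩
    · obtain ⟨y, hy, hgy⟩ := exists_pos_of_one_le_sum (hP x hx hpos)
      exact ⟨y, (Finset.mem_filter.mp hy).1, hgy, (Finset.mem_filter.mp hy).2⟩
    · obtain ⟨x, hx, hgx⟩ := exists_pos_of_one_le_sum (hN y hy hpos)
      exact ⟨x, (Finset.mem_filter.mp hx).1, hgx, (Finset.mem_filter.mp hx).2⟩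
  · rintro ⟨hP, hN⟩
    refine ⟨fun x hx hpos => ?_, fun y hy hpos => ?_⟩
    · obtain ⟨y, hy, hgy, hl⟩ := hP x hx hpos
      exact one_le_sum_of_mem_pos (Finset.mem_filter.mpr ⟨hy, hl⟩) hgy
    · obtain ⟨x, hx, hgx, hl⟩ := hN y hy hpos
      exact one_le_sum_of_mem_pos (Finset.mem_filter.mpr ⟨hx, hl⟩) hgx

/-- the BRANCHING reading of a cover row (the first level of branch-and-bound on presence): for every N cell `y` of `U`,
EITHER `gN y = 0` OR the P cells below it carry mass `≥ 1`; dually for P cells. -/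
theorem coverRow_branch {U : Finset Cell} {gN gP : Cell → ℕ} (h : CoverRowsFun U gN gP) :
    (∀ y ∈ U, gN y = 0 ∨ 1 ≤ ∑ x ∈ U.filter (fun x => Live x y), gP x) ∧
    (∀ x ∈ U, gP x = 0 ∨ 1 ≤ ∑ y ∈ U.filter (fun y => Live x y), gN y) :=
  ⟨fun y hy => (Nat.eq_zero_or_pos (gN y)).imp id (h.2 y hy),
   fun x hx => (Nat.eq_zero_or_pos (gP x)).imp id (h.1 x hx)⟩

/-- the cover rows of the design realised from `(gN, gP)` — every (A4) assignment on `U` satisfies them (via `a4_realise`-free route: directly). -/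
theorem coverRowsFun_of_A4fun {U : Finset Cell} {gN gP : Cell → ℕ} (h4 : A4fun U gN gP) : CoverRowsFun U gN gP :=
  (coverRowsFun_iff_A4fun U gN gP).mpr h4

/-! ### §1.4 SHADOW ROWS (v2.1): the type ∕ shape-multiset shadows `⊲_T`, `⊲_S` of joint memo B.2 and the KERNEL SOUNDNESS of every shadow row

A linear programme over TYPE (or shape-class) masses cannot carry `Live` itself; it carries a SHADOW relation `R ⊇ Live` (B.2: type(c) ⊲_T type(y),
shape-multiset(c) ⊲_S shape-multiset(y); s4's KILL-TEST(L1) branch A row «Σ_{t ⊲_S s*} x_t ≥ 1»). Soundness of every such row at an (A4) INTEGER point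
is monotonicity: the cover row over `Live` (threshold 1, `coverRowsFun_of_A4fun`) is dominated by the row over any `R ⊇ Live` (`shadowRows_of_A4fun`).
We type the two shadows of record with the 8 dihedral PLACEMENTS of a letter (turns `β ↦ iβ` and conjugation); any coarser or finer shadow containing
`Live` is covered by the general statement. Branch form (`shadow_branch`): for every `y ∈ U`, `gN y = 0` (branch B: delete the column) or the shadow
row holds (branch A) — the KILL-TEST pair is exhaustive at every (A4) integer point. -/

/-- the 8 placements of a letter: its images under slot turns and conjugation (the letter orbit of its shape). -/
def placements (ℓ : Letter) : List Letter :=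
  [ℓ, ⟨ℓ.a, -ℓ.y, ℓ.x⟩, ⟨ℓ.a, -ℓ.x, -ℓ.y⟩, ⟨ℓ.a, ℓ.y, -ℓ.x⟩, ⟨ℓ.a, ℓ.x, -ℓ.y⟩, ⟨ℓ.a, ℓ.y, ℓ.x⟩, ⟨ℓ.a, -ℓ.x, ℓ.y⟩, ⟨ℓ.a, -ℓ.y, -ℓ.x⟩]

theorem mem_placements_self (ℓ : Letter) : ℓ ∈ placements ℓ := by simp [placements]

/-- shape relation `σ ⊲ τ`: some placement of `ℓ` is amply below some placement of `ℓ'`. -/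
def ShapeBelow (ℓ ℓ' : Letter) : Prop := ∃ p ∈ placements ℓ, ∃ p' ∈ placements ℓ', AmpleAbove p p'

instance decShapeBelow (ℓ ℓ' : Letter) : Decidable (ShapeBelow ℓ ℓ') := by unfold ShapeBelow; infer_instance

theorem shapeBelow_of_ampleAbove {ℓ ℓ' : Letter} (h : AmpleAbove ℓ ℓ') : ShapeBelow ℓ ℓ' :=
  ⟨ℓ, mem_placements_self ℓ, ℓ', mem_placements_self ℓ', h⟩

/-- TYPE shadow `x ⊲_T y` (B.2): slotwise shape relation. -/
def TypeBelow (x y : Cell) : Prop := ∀ f : Fin 4, ShapeBelow (x f) (y f)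

/-- SHAPE-MULTISET shadow `x ⊲_S y` (B.2): some slot bijection matches the shapes of `x` below those of `y`. -/
def MultisetBelow (x y : Cell) : Prop := ∃ π : Equiv.Perm (Fin 4), ∀ f : Fin 4, ShapeBelow (x (π f)) (y f)

instance decTypeBelow (x y : Cell) : Decidable (TypeBelow x y) := by unfold TypeBelow; infer_instance
instance decMultisetBelow (x y : Cell) : Decidable (MultisetBelow x y) := by unfold MultisetBelow; infer_instance

theorem typeBelow_of_live {x y : Cell} (h : Live x y) : TypeBelow x y := fun f => shapeBelow_of_ampleAbove (h f)

theorem multisetBelow_of_typeBelow {x y : Cell} (h : TypeBelow x y) : MultisetBelow x y := ⟨1, fun f => by simpa using h f⟩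

theorem multisetBelow_of_live {x y : Cell} (h : Live x y) : MultisetBelow x y := multisetBelow_of_typeBelow (typeBelow_of_live h)

/-- **KERNEL SOUNDNESS OF SHADOW ROWS:** for ANY relation `R ⊇ Live`, every (A4) assignment on `U` satisfies the `R`-cover rows with threshold `1`
in both directions. -/
theorem shadowRows_of_A4fun {U : Finset Cell} {gN gP : Cell → ℕ} (R : Cell → Cell → Prop) [∀ x y, Decidable (R x y)]
    (hR : ∀ x y, Live x y → R x y) (h4 : A4fun U gN gP) :
    (∀ x ∈ U, 0 < gP x → 1 ≤ ∑ y ∈ U.filter (fun y => R x y), gN y) ∧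
      (∀ y ∈ U, 0 < gN y → 1 ≤ ∑ x ∈ U.filter (fun x => R x y), gP x) := by
  have h := coverRowsFun_of_A4fun h4
  refine ⟨fun x hx hpos => le_trans (h.1 x hx hpos) (Finset.sum_le_sum_of_subset fun y hy => ?_),
    fun y hy hpos => le_trans (h.2 y hy hpos) (Finset.sum_le_sum_of_subset fun x hx' => ?_)⟩
  · exact Finset.mem_filter.mpr ⟨(Finset.mem_filter.mp hy).1, hR _ _ (Finset.mem_filter.mp hy).2⟩
  · exact Finset.mem_filter.mpr ⟨(Finset.mem_filter.mp hx').1, hR _ _ (Finset.mem_filter.mp hx').2⟩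

/-- the TYPE-shadow rows hold at every (A4) assignment. -/
theorem typeShadowRows_of_A4fun {U : Finset Cell} {gN gP : Cell → ℕ} (h4 : A4fun U gN gP) :
    (∀ x ∈ U, 0 < gP x → 1 ≤ ∑ y ∈ U.filter (fun y => TypeBelow x y), gN y) ∧
      (∀ y ∈ U, 0 < gN y → 1 ≤ ∑ x ∈ U.filter (fun x => TypeBelow x y), gP x) :=
  shadowRows_of_A4fun TypeBelow (fun _ _ => typeBelow_of_live) h4

/-- the SHAPE-MULTISET-shadow rows (s4's KILL-TEST(L1) branch A rows, cell-level reading) hold at every (A4) assignment. -/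
theorem multisetShadowRows_of_A4fun {U : Finset Cell} {gN gP : Cell → ℕ} (h4 : A4fun U gN gP) :
    (∀ x ∈ U, 0 < gP x → 1 ≤ ∑ y ∈ U.filter (fun y => MultisetBelow x y), gN y) ∧
      (∀ y ∈ U, 0 < gN y → 1 ≤ ∑ x ∈ U.filter (fun x => MultisetBelow x y), gP x) :=
  shadowRows_of_A4fun MultisetBelow (fun _ _ => multisetBelow_of_live) h4

/-- **the KILL-TEST pair is exhaustive:** at an (A4) integer point, for every N cell `y` of `U` either its column is zero (branch B) or the shadow
row over any `R ⊇ Live` holds (branch A); dually for P cells. -/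
theorem shadow_branch {U : Finset Cell} {gN gP : Cell → ℕ} (R : Cell → Cell → Prop) [∀ x y, Decidable (R x y)]
    (hR : ∀ x y, Live x y → R x y) (h4 : A4fun U gN gP) :
    (∀ y ∈ U, gN y = 0 ∨ 1 ≤ ∑ x ∈ U.filter (fun x => R x y), gP x) ∧
      (∀ x ∈ U, gP x = 0 ∨ 1 ≤ ∑ y ∈ U.filter (fun y => R x y), gN y) := by
  have h := shadowRows_of_A4fun R hR h4
  refine ⟨fun y hy => ?_, fun x hx => ?_⟩
  · rcases Nat.eq_zero_or_pos (gN y) with h0 | hpos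
    · exact Or.inl h0
    · exact Or.inr (h.2 y hy hpos)
  · rcases Nat.eq_zero_or_pos (gP x) with h0 | hpos
    · exact Or.inl h0
    · exact Or.inr (h.1 x hx hpos)

/-! ## §2 L2 — CLOSURE FIXPOINT (joint memo B.2): intermediate covers, every depth -/

/-- ONE PRUNING ROUND on a support pair `(A, B)` (N cells `A`, P cells `B`): delete the N cells with no cover in `B` and the P cells with no
co-cover in `A`. -/
def prune (AB : Finset Cell × Finset Cell) : Finset Cell × Finset Cell :=
  (AB.1.filter fun y => ∃ c ∈ AB.2, Live c y, AB.2.filter fun c => ∃ y ∈ AB.1, Live c y)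

theorem prune_fst_subset (AB : Finset Cell × Finset Cell) : (prune AB).1 ⊆ AB.1 := Finset.filter_subset _ _
theorem prune_snd_subset (AB : Finset Cell × Finset Cell) : (prune AB).2 ⊆ AB.2 := Finset.filter_subset _ _

/-- a pair is cover-closed iff it is a fixed point of `prune`. -/
theorem coverClosed_iff_prune_eq (A B : Finset Cell) : CoverClosed A B ↔ prune (A, B) = (A, B) := by
  constructor
  · rintro ⟨hN, hP⟩
    refine Prod.ext ?_ ?_
    · exact Finset.filter_true_of_mem (fun y hy => hN y hy)
    · exact Finset.filter_true_of_mem (fun c hc => hP c hc)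
  · intro h
    have h1 : A.filter (fun y => ∃ c ∈ B, Live c y) = A := congrArg Prod.fst h
    have h2 : B.filter (fun c => ∃ y ∈ A, Live c y) = B := congrArg Prod.snd h
    refine ⟨fun y hy => ?_, fun c hc => ?_⟩
    · rw [← h1] at hy; exact (Finset.mem_filter.mp hy).2
    · rw [← h2] at hc; exact (Finset.mem_filter.mp hc).2

/-- a cover-closed pair inside `(A, B)` survives a pruning round. -/
theorem subset_prune_of_closed {SN SP : Finset Cell} (hc : CoverClosed SN SP) {AB : Finset Cell × Finset Cell}
    (hN : SN ⊆ AB.1) (hP : SP ⊆ AB.2) : SN ⊆ (prune AB).1 ∧ SP ⊆ (prune AB).2 := by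
  refine ⟨fun y hy => Finset.mem_filter.mpr ⟨hN hy, ?_⟩, fun c hc' => Finset.mem_filter.mpr ⟨hP hc', ?_⟩⟩
  · obtain ⟨c, hcS, hl⟩ := hc.1 y hy
    exact ⟨c, hP hcS, hl⟩
  · obtain ⟨y, hyS, hl⟩ := hc.2 c hc'
    exact ⟨y, hN hyS, hl⟩

/-- … hence survives every number of rounds: a cover-closed pair inside `(A, B)` lies in the `k`-round CORE `prune^[k] (A, B)`. -/
theorem subset_iterate_prune_of_closed {SN SP : Finset Cell} (hc : CoverClosed SN SP) :
    ∀ (k : ℕ) (AB : Finset Cell × Finset Cell), SN ⊆ AB.1 → SP ⊆ AB.2 →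
      SN ⊆ (prune^[k] AB).1 ∧ SP ⊆ (prune^[k] AB).2 := by
  intro k
  induction k with
  | zero => intro AB hN hP; exact ⟨hN, hP⟩
  | succ k ih =>
    intro AB hN hP
    have h1 := subset_prune_of_closed hc hN hP
    rw [Function.iterate_succ_apply]
    exact ih (prune AB) h1.1 h1.2

/-- **L2 (graded): `CIL k`** — an (A4) design whose N cells lie in `A` and whose P cells lie in `B` has all its cells in the `k`-round core
`prune^[k] (A, B)`. («Every design in a region must use cells OUTSIDE the phantom's support or live in its closed core»; on T158 the cores have
rank ≤ 2.84 < 8, joint memo B.2.) -/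
def CIL (k : ℕ) : Prop :=
  ∀ D : Design, D.A4 → ∀ A B : Finset Cell, (∀ y ∈ D.suppN, y ∈ A) → (∀ c ∈ D.suppP, c ∈ B) →
    (∀ y ∈ D.suppN, y ∈ (prune^[k] (A, B)).1) ∧ (∀ c ∈ D.suppP, c ∈ (prune^[k] (A, B)).2)

/-- **L2 as one law:** all depths at once. -/
def ClosureFixpointLaw : Prop := ∀ k : ℕ, CIL k

/-- SOUNDNESS of L2: iterate L1. -/
theorem supp_subset_iterate_prune {D : Design} (h4 : D.A4) {A B : Finset Cell} (hN : ∀ y ∈ D.suppN, y ∈ A)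
    (hP : ∀ c ∈ D.suppP, c ∈ B) (k : ℕ) :
    (∀ y ∈ D.suppN, y ∈ (prune^[k] (A, B)).1) ∧ (∀ c ∈ D.suppP, c ∈ (prune^[k] (A, B)).2) := by
  have h := subset_iterate_prune_of_closed (coverClosed_of_A4 h4) k (A, B)
    (fun y hy => hN y (List.mem_toFinset.mp hy)) (fun c hc => hP c (List.mem_toFinset.mp hc))
  exact ⟨fun y hy => h.1 (List.mem_toFinset.mpr hy), fun c hc => h.2 (List.mem_toFinset.mpr hc)⟩

theorem cil_holds (k : ℕ) : CIL k := fun _ h4 _ _ hN hP => supp_subset_iterate_prune h4 hN hP k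

theorem closureFixpointLaw_holds : ClosureFixpointLaw := cil_holds

/-- L2 in FUNCTION FORM on `U`: the live part of an (A4) assignment lies in every core of `(U, U)` — equivalently, at a search node whose
remaining universe is `(A, B)`, cells outside `prune^[k] (A, B)` can be fixed to `0` (a sound pruning rule, every `k`). -/
theorem support_in_core_fun {U : Finset Cell} {gN gP : Cell → ℕ} (h4 : A4fun U gN gP) (k : ℕ) :
    (∀ y ∈ U, 0 < gN y → y ∈ (prune^[k] (U, U)).1) ∧ (∀ x ∈ U, 0 < gP x → x ∈ (prune^[k] (U, U)).2) := by
  have hc : CoverClosed (U.filter fun y => 0 < gN y) (U.filter fun x => 0 < gP x) := by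
    refine ⟨fun y hy => ?_, fun x hx => ?_⟩
    · obtain ⟨x, hxU, hgx, hl⟩ := h4.2 y (Finset.mem_filter.mp hy).1 (Finset.mem_filter.mp hy).2
      exact ⟨x, Finset.mem_filter.mpr ⟨hxU, hgx⟩, hl⟩
    · obtain ⟨y, hyU, hgy, hl⟩ := h4.1 x (Finset.mem_filter.mp hx).1 (Finset.mem_filter.mp hx).2
      exact ⟨y, Finset.mem_filter.mpr ⟨hyU, hgy⟩, hl⟩
  have h := subset_iterate_prune_of_closed hc k (U, U) (Finset.filter_subset _ _) (Finset.filter_subset _ _)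
  exact ⟨fun y hy hpos => h.1 (Finset.mem_filter.mpr ⟨hy, hpos⟩), fun x hx hpos => h.2 (Finset.mem_filter.mpr ⟨hx, hpos⟩)⟩

/-! ## §3 L1⁺ — COVER COUNT at `h = 6` (joint memo B.3) -/

/-- the floor letters (`a = 0`) and the height-2 letters of the height-6 box, as explicit lists for the kernel. -/
def floorLetters6 : List Letter := (boxList 6 6).filter fun ℓ => ℓ.a = 0
def twoLetters6 : List Letter := (boxList 6 6).filter fun ℓ => ℓ.a = 2

example : floorLetters6.length = 24 ∧ twoLetters6.length = 16 := by decide +kernel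

set_option maxRecDepth 65536 in
/-- **(F1)** at `h = 6`: a letter of the alphabet amply below a height-2 letter is a floor letter (height 1 would need distance 0). -/
theorem F1_six : ∀ ℓ ∈ boxList 6 6, 0 ≤ ℓ.a → ∀ ℓ' ∈ twoLetters6, AmpleAbove ℓ ℓ' → ℓ.a = 0 := by
  decide +kernel

set_option maxRecDepth 65536 in
/-- **(F2)** at `h = 6`: a floor letter is amply below AT MOST ONE height-2 letter (`m → b`, `g → r`, `f → q` with their placements). -/
theorem F2_six : ∀ ℓ ∈ floorLetters6, ∀ ℓ₁ ∈ twoLetters6, ∀ ℓ₂ ∈ twoLetters6, AmpleAbove ℓ ℓ₁ → AmpleAbove ℓ ℓ₂ → ℓ₁ = ℓ₂ := by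
  decide +kernel

/-- bottom⁴ cells: all four letters of height `2`. (`famFloor` of `FinCheck`: all four letters of height `0`.) -/
def famTwo (c : Cell) : Prop := ∀ f : Fin 4, (c f).a = 2

instance decFamTwo : DecidablePred famTwo := fun c => by unfold famTwo; infer_instance

/-- **L1⁺ COVER COUNT LAW (h = 6)** — «for every (A4) design on the height-6 alphabet, the number of DISTINCT bottom⁴ N cells is at most the total
multiplicity of the floor⁴ P cells» (by (A4) each present bottom⁴ N cell `y` has a present cover `c ⊲ y`; by (F1) `c` is floor⁴; by (F2) `c` determines
`y`; present ⇒ mass `≥ 1`). KERNEL: `coverCountLaw6_holds` (§3.1). With an LP∕Farkas bound `Σ_{floor⁴} m_P ≤ d̄` under (A1) ∧ budget (e.g.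
`floor4_family_mass_le : … ≤ 14` of `FinCheck` §10.7 at `(6, 199)`) it caps the number of distinct bottom⁴ N cells — a cardinality cut no LP produces. -/
def CoverCountLaw6 : Prop :=
  ∀ D : Design, D.OnAlphabet 6 → D.A4 →
    (D.suppN.toFinset.filter famTwo).card ≤ ∑ c ∈ D.suppP.toFinset.filter famFloor, D.mP c

/-- L1⁺ in FUNCTION FORM on `U ⊆ cellsOn 6`: `#{y ∈ U bottom⁴, gN y > 0} ≤ Σ_{c ∈ U floor⁴} gP c`. -/
def CoverCountRowFun (U : Finset Cell) (gN gP : Cell → ℕ) : Prop :=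
  (U.filter fun y => famTwo y ∧ 0 < gN y).card ≤ ∑ c ∈ U.filter famFloor, gP c

/-- the function-form law at `h = 6` (KERNEL: `coverCountLawFun6_holds`): every (A4) assignment on a `U ⊆ cellsOn 6` satisfies the count row. -/
def CoverCountLawFun6 : Prop :=
  ∀ U : Finset Cell, U ⊆ cellsOn 6 → ∀ gN gP : Cell → ℕ, A4fun U gN gP → CoverCountRowFun U gN gP

/-! ### §3.1 KERNEL PROOF of L1⁺ (v1.1): the injection `y ↦ cover(y)` from (F1) ∕ (F2) -/

theorem mem_twoLetters6 {ℓ : Letter} (h : ℓ.OnAlphabet 6) (ha : ℓ.a = 2) : ℓ ∈ twoLetters6 :=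
  List.mem_filter.mpr ⟨mem_boxList_six h, by simp [ha]⟩

theorem mem_floorLetters6 {ℓ : Letter} (h : ℓ.OnAlphabet 6) (ha : ℓ.a = 0) : ℓ ∈ floorLetters6 :=
  List.mem_filter.mpr ⟨mem_boxList_six h, by simp [ha]⟩

/-- (F1) on cells: a cover of a bottom⁴ cell is a floor⁴ cell. -/
theorem famFloor_of_live_famTwo {x y : Cell} (hx : ∀ f, (x f).OnAlphabet 6) (hy : ∀ f, (y f).OnAlphabet 6) (h2 : famTwo y)
    (hl : Live x y) : famFloor x :=
  fun f => F1_six (x f) (mem_boxList_six (hx f)) (hx f).2 (y f) (mem_twoLetters6 (hy f) (h2 f)) (hl f)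

/-- (F2) on cells: a floor⁴ cell covers at most one bottom⁴ cell. -/
theorem famTwo_eq_of_live {x y₁ y₂ : Cell} (hx : ∀ f, (x f).OnAlphabet 6) (hy₁ : ∀ f, (y₁ f).OnAlphabet 6)
    (hy₂ : ∀ f, (y₂ f).OnAlphabet 6) (hfx : famFloor x) (h₁ : famTwo y₁) (h₂ : famTwo y₂) (hl₁ : Live x y₁) (hl₂ : Live x y₂) :
    y₁ = y₂ :=
  funext fun f => F2_six (x f) (mem_floorLetters6 (hx f) (hfx f)) (y₁ f) (mem_twoLetters6 (hy₁ f) (h₁ f)) (y₂ f)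
    (mem_twoLetters6 (hy₂ f) (h₂ f)) (hl₁ f) (hl₂ f)

/-- the counting core: bottom⁴ cells with covers in `SP` inject into the floor⁴ cells of `SP`. -/
theorem card_two_le_card_floor {SN SP : Finset Cell} (hAN : ∀ y ∈ SN, ∀ f, (y f).OnAlphabet 6)
    (hAP : ∀ x ∈ SP, ∀ f, (x f).OnAlphabet 6) (h2 : ∀ y ∈ SN, famTwo y) (hcov : ∀ y ∈ SN, ∃ x ∈ SP, Live x y) :
    SN.card ≤ (SP.filter famFloor).card := by
  classical
  haveI : Nonempty Cell := ⟨fun _ => ⟨0, 0, 0⟩⟩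
  choose! cov hmem hlive using hcov
  have hmaps : ∀ y ∈ SN, cov y ∈ SP.filter famFloor := fun y hy =>
    Finset.mem_filter.mpr ⟨hmem y hy, famFloor_of_live_famTwo (hAP _ (hmem y hy)) (hAN y hy) (h2 y hy) (hlive y hy)⟩
  have hinj : Set.InjOn cov ↑SN := by
    intro y₁ hy₁ y₂ hy₂ heq
    have hy₁' : y₁ ∈ SN := Finset.mem_coe.mp hy₁
    have hy₂' : y₂ ∈ SN := Finset.mem_coe.mp hy₂
    have hfl : famFloor (cov y₁) := (Finset.mem_filter.mp (hmaps y₁ hy₁')).2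
    have hl₂ : Live (cov y₁) y₂ := by rw [heq]; exact hlive y₂ hy₂'
    exact famTwo_eq_of_live (hAP _ (hmem y₁ hy₁')) (hAN y₁ hy₁') (hAN y₂ hy₂') hfl (h2 y₁ hy₁') (h2 y₂ hy₂')
      (hlive y₁ hy₁') hl₂
  exact Finset.card_le_card_of_injOn cov (fun y hy => hmaps y hy) hinj

/-- present cells have mass `≥ 1`, so a cardinality is at most a mass. -/
theorem card_le_sum_of_pos {S : Finset Cell} {g : Cell → ℕ} (hpos : ∀ c ∈ S, 0 < g c) : S.card ≤ ∑ c ∈ S, g c := by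
  rw [Finset.card_eq_sum_ones]
  exact Finset.sum_le_sum fun c hc => Nat.succ_le_of_lt (hpos c hc)

/-- **L1⁺ COVER COUNT LAW at `h = 6` — KERNEL.** -/
theorem coverCountLaw6_holds : CoverCountLaw6 := by
  intro D hA h4
  have hAN : ∀ y ∈ D.suppN.toFinset.filter famTwo, ∀ f, (y f).OnAlphabet 6 := fun y hy f =>
    hA y (List.mem_append_left _ (List.mem_toFinset.mp (Finset.mem_filter.mp hy).1)) f
  have hAP : ∀ x ∈ D.suppP.toFinset, ∀ f, (x f).OnAlphabet 6 := fun x hx f =>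
    hA x (List.mem_append_right _ (List.mem_toFinset.mp hx)) f
  have hcov : ∀ y ∈ D.suppN.toFinset.filter famTwo, ∃ x ∈ D.suppP.toFinset, Live x y := fun y hy => by
    obtain ⟨x, hx, hl⟩ := h4.2 y (List.mem_toFinset.mp (Finset.mem_filter.mp hy).1)
    exact ⟨x, List.mem_toFinset.mpr hx, hl⟩
  have h1 := card_two_le_card_floor hAN hAP (fun y hy => (Finset.mem_filter.mp hy).2) hcov
  have h2 : (D.suppP.toFinset.filter famFloor).card ≤ ∑ c ∈ D.suppP.toFinset.filter famFloor, D.mP c :=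
    card_le_sum_of_pos fun c hc => (mem_suppP_iff_pos D c).mp (List.mem_toFinset.mp (Finset.mem_filter.mp hc).1)
  exact le_trans h1 h2

/-- cells of a `U ⊆ cellsOn h` are on the alphabet (generic `h`, so that no literal `cellsOn 6` is ever unfolded). -/
theorem onAlphabet_of_subset_cellsOn {h : ℤ} {U : Finset Cell} (hU : U ⊆ cellsOn h) : ∀ c ∈ U, ∀ f, (c f).OnAlphabet h :=
  fun _ hc f => mem_cellsOn.mp (hU hc) f

/-- **L1⁺ in FUNCTION FORM at `h = 6` — KERNEL:** on any `U ⊆ cellsOn 6`, every (A4) assignment has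
`#{y ∈ U : bottom⁴, gN y > 0} ≤ Σ_{c ∈ U : floor⁴} gP c` (a cardinality row valid at every search node; with `floor4_row_fun … ≤ 14` of `FinCheck`
§10.9 it caps the number of live bottom⁴ N cells at `14` under (A1) ∧ (A4) ∧ copies ≤ 199). -/
theorem coverCountLawFun6_holds : CoverCountLawFun6 := by
  intro U hU gN gP h4
  unfold CoverCountRowFun
  have hAU : ∀ c ∈ U, ∀ f, (c f).OnAlphabet 6 := onAlphabet_of_subset_cellsOn hU
  have hAN : ∀ y ∈ U.filter (fun y => famTwo y ∧ 0 < gN y), ∀ f, (y f).OnAlphabet 6 := fun y hy =>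
    hAU y (Finset.mem_filter.mp hy).1
  have hAP : ∀ x ∈ U.filter (fun x => 0 < gP x), ∀ f, (x f).OnAlphabet 6 := fun x hx => hAU x (Finset.mem_filter.mp hx).1
  have hcov : ∀ y ∈ U.filter (fun y => famTwo y ∧ 0 < gN y), ∃ x ∈ U.filter (fun x => 0 < gP x), Live x y := fun y hy => by
    obtain ⟨hyU, _, hpos⟩ := Finset.mem_filter.mp hy
    obtain ⟨x, hxU, hgx, hl⟩ := h4.2 y hyU hpos
    exact ⟨x, Finset.mem_filter.mpr ⟨hxU, hgx⟩, hl⟩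
  have h1 := card_two_le_card_floor hAN hAP (fun y hy => (Finset.mem_filter.mp hy).2.1) hcov
  have h2 : ((U.filter fun x => 0 < gP x).filter famFloor).card ≤ ∑ c ∈ (U.filter fun x => 0 < gP x).filter famFloor, gP c :=
    card_le_sum_of_pos fun c hc => (Finset.mem_filter.mp (Finset.mem_filter.mp hc).1).2
  have h3 : ∑ c ∈ (U.filter fun x => 0 < gP x).filter famFloor, gP c ≤ ∑ c ∈ U.filter famFloor, gP c :=
    Finset.sum_le_sum_of_subset fun c hc =>
      Finset.mem_filter.mpr ⟨(Finset.mem_filter.mp (Finset.mem_filter.mp hc).1).1, (Finset.mem_filter.mp hc).2⟩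
  exact le_trans h1 (le_trans h2 h3)

/-- the count law bundled with the all-floor row of `FinCheck` §10.9: under (A1) ∧ (A4) ∧ copies `≤ 199` on a `U ⊆ cellsOn 6`, at most `14`
bottom⁴ N cells are live. -/
theorem live_bottom4_card_le_14 {U : Finset Cell} (hU : U ⊆ cellsOn 6) {gN gP : Cell → ℕ} (h1 : A1fun U gN gP)
    (h4 : A4fun U gN gP) (hB : copiesfun U gN gP ≤ 199) : (U.filter fun y => famTwo y ∧ 0 < gN y).card ≤ 14 :=
  le_trans (coverCountLawFun6_holds U hU gN gP h4) (rows_fun hU h1 h4 hB).2.2.2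

/-! ## §4 L0 — the SUPPORT NO-GOOD ROW (joint memo A.3; R19.517 (1) «can L0 be a row? — yes, this one; one per (region, support)») -/

/-- **L0 as a ROW.** For a universe `U`, a cell set `T` («the phantom's support», at cell level a union of shape classes), a budget `B`, a rank
floor `rmin` and a REGION predicate `R` (the branch constraints — attained caps — of the region the phantom lives in; `R := fun _ _ => True` for
«all designs»): every (A1) ∧ (A4) assignment on `U` with copies `≤ B`, rank `≥ rmin`, a floor letter, and `R`, puts total mass `≥ 1` OUTSIDE `T`.
Sound for `(R, T)` exactly when `T` carries no such assignment — what the lattice probe ×2 (s4 g33 ∕ idea-crit-hsem-4 g8) reports for the 13 lowest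
phantom supports (on a RELAXATION: e-free rows + rank + floor + attained caps, so probe-empty ⇒ row sound); kernel replay would be a bounded
ℤ-lattice emptiness certificate per support (not typed here). It is NOT a single support-independent row; and «support marginal integrality» itself
(the shape-count vector of a design is an integer point of the class system) is the typing `gN gP : Cell → ℕ`, not a linear row. -/
def SupportNoGoodRow (U T : Finset Cell) (B : ℕ) (rmin : ℤ) (R : (Cell → ℕ) → (Cell → ℕ) → Prop) : Prop :=
  ∀ gN gP : Cell → ℕ, A1fun U gN gP → A4fun U gN gP → copiesfun U gN gP ≤ B → rmin ≤ rankfun U gN gP →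
    ¬ NoFloor U gN gP → R gN gP → 1 ≤ ∑ c ∈ U \ T, (gN c + gP c)

/-- the row says exactly «no admissible floor assignment of the region is supported inside `T`». -/
theorem supportNoGoodRow_iff (U T : Finset Cell) (B : ℕ) (rmin : ℤ) (R : (Cell → ℕ) → (Cell → ℕ) → Prop) :
    SupportNoGoodRow U T B rmin R ↔
      ∀ gN gP : Cell → ℕ, A1fun U gN gP → A4fun U gN gP → copiesfun U gN gP ≤ B → rmin ≤ rankfun U gN gP →
        ¬ NoFloor U gN gP → R gN gP → ∃ c ∈ U \ T, 0 < gN c + gP c := by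
  constructor
  · intro h gN gP h1 h4 hB hr hf hR
    exact exists_pos_of_one_le_sum (h gN gP h1 h4 hB hr hf hR)
  · intro h gN gP h1 h4 hB hr hf hR
    obtain ⟨c, hc, hpos⟩ := h gN gP h1 h4 hB hr hf hR
    exact one_le_sum_of_mem_pos hc hpos

/-! ## §5 The node's UMBRELLA (v1) -/

/-- **COVER-INTEGRALITY LAW (umbrella, v1)** := L1 (cover closure) ∧ L2 (closure fixpoint, all depths) ∧ L1⁺ (cover count at `h = 6`).
L1 and L2 are THEOREMS of (A4) + integrality (`coverClosureLaw_holds`, `closureFixpointLaw_holds`), so the umbrella is equivalent to `CoverCountLaw6`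
(`coverIntegralityLaw_iff`); the graded family is `CIL k` (§2). The LP-graded KILL-TESTs of the node (joint memo B.2 HARNESS FORM) are applications of
`coverRow_branch` ∕ `support_in_core_fun` at a search node; L0 rows (§4) are per-(region, support) and enter as hypotheses where certified. -/
def CoverIntegralityLaw : Prop := CoverClosureLaw ∧ ClosureFixpointLaw ∧ CoverCountLaw6

theorem coverIntegralityLaw_iff : CoverIntegralityLaw ↔ CoverCountLaw6 :=
  ⟨fun h => h.2.2, fun h => ⟨coverClosureLaw_holds, closureFixpointLaw_holds, h⟩⟩

/-- the v1 umbrella HOLDS (all three members are kernel theorems). -/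
theorem coverIntegralityLaw_holds : CoverIntegralityLaw :=
  ⟨coverClosureLaw_holds, closureFixpointLaw_holds, coverCountLaw6_holds⟩

/-! ## §6 THE SYMMETRY LEMMA in kernel form (joint memo B.1 = the node's framing sentence, R19.518 (3); v2)

B.1 says: for an LP whose rows other than (A1).1 are TYPE FUNCTIONS, the uniform-on-types lift of a type point is optimal and annihilates every
(A1).1 row identically, μ included — «the symmetric point has μ = 0», so cell-level information enters ONLY through symmetry-breaking inputs
(integrality ∕ presence, μ ≠ 0, cell-wise cover rows). A type is a torus orbit: the cells obtained from one cell by independent quarter turns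
`β ↦ iβ` on the four slots (`B4FloorSymmetry.rotAt j`, whose letter map is `DepthBoundA4.Letter.rotI`). «Uniform on types» is therefore the special
case «invariant under every slot turn» of the hypothesis used below, and the kernel statement is:

**on a turn-closed cell set `U`, a turn-invariant weight `g : Cell → ℤ[i]` has `Σ_{c ∈ U} g c · cellCoef c w = 0` for every word `w` with an
`e`∕`ē` slot** (`rowSum_eq_zero_of_symmetric`): turning slot `j` re-indexes the sum over `U` (a bijection, `rotAt_four`) and multiplies every term by the
unit `rotUnit (w j) ∈ {−i, i}` (`B4FloorSymmetry.cellCoef_rotAt`), so `S = ±i·S`, i.e. `S = 0` in `ℤ[i]`. Consequences in `FinCheck` letter: a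
turn-symmetric assignment `(gN, gP)` on a turn-closed `U` (e.g. `U = cellsOn h`, `turnClosed_cellsOn`) satisfies EVERY (A1).1 row
(`symmetricPoint_A1_1`) and has `mufun U gN gP = 0` (`symmetricPoint_mu_eq_zero`) — it is never a floor witness; and e-free rows are turn-invariant
(`cellCoef_rotAt_efree`), i.e. type functions. Weights in `ℤ[i]` cover ℕ-assignments and, by homogeneity, rational LP points up to a common denominator.
NOT typed: the «(≥)» aggregation half of B.1 (a cell point aggregates to a type point with the same type-function rows — bookkeeping) and LP optimality. -/

section symmetry
open Summit.HodgeConjecture.HodgeConjecture.Cruxes.BlochSeedDiscOne.B4FloorSymmetry (rotAt rotAt_self rotAt_of_ne rotUnit rotUnit_of_efree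
  cellCoef_rotAt onAlphabet_rotI live_rotAt)

variable (U : Finset Cell)

/-- four quarter turns of one slot are the identity. -/
theorem rotAt_four (j : Fin 4) (c : Cell) : rotAt j (rotAt j (rotAt j (rotAt j c))) = c := by
  funext f
  by_cases hf : f = j
  · subst hf
    rw [rotAt_self, rotAt_self, rotAt_self, rotAt_self]
    generalize c f = ℓ
    cases ℓ; simp [Letter.rotI]
  · simp only [rotAt_of_ne hf]

/-- `U` is closed under every slot turn. -/
def TurnClosed : Prop := ∀ j : Fin 4, ∀ c ∈ U, rotAt j c ∈ U

/-- the weight `g` is invariant under every slot turn on `U` («`g` is a type function on `U`»). -/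
def TurnInvariantOn (g : Cell → GaussianInt) : Prop := ∀ j : Fin 4, ∀ c ∈ U, g (rotAt j c) = g c

theorem rotAt_three_mem {U : Finset Cell} (hU : TurnClosed U) (j : Fin 4) {c : Cell} (hc : c ∈ U) :
    rotAt j (rotAt j (rotAt j c)) ∈ U :=
  hU j _ (hU j _ (hU j _ hc))

/-- every alphabet universe `cellsOn h` is turn-closed. -/
theorem turnClosed_cellsOn (h : ℤ) : TurnClosed (cellsOn h) := fun j c hc =>
  mem_cellsOn.mpr fun f => by
    by_cases hf : f = j
    · subst hf; rw [rotAt_self]; exact (onAlphabet_rotI h _).mpr (mem_cellsOn.mp hc f)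
    · rw [rotAt_of_ne hf]; exact mem_cellsOn.mp hc f

/-- slot turns preserve `Live` (so they act on (A4) data as well: `B4FloorSymmetry.live_rotAt`). -/
theorem live_rotAt_iff (j : Fin 4) (x y : Cell) : Live (rotAt j x) (rotAt j y) ↔ Live x y := live_rotAt j x y

/-- the `g`-weighted row of the word `w` on `U`. -/
def rowSum (g : Cell → GaussianInt) (w : Word) : GaussianInt := ∑ c ∈ U, g c * cellCoef c w

theorem Tfun_eq_rowSum (gN gP : Cell → ℕ) (w : Word) :
    Tfun U gN gP w = rowSum U (fun c => (gN c : GaussianInt)) w - rowSum U (fun c => (gP c : GaussianInt)) w := rfl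

/-- e-free rows are type functions: invariant under every slot turn. -/
theorem cellCoef_rotAt_efree (j : Fin 4) (c : Cell) {w : Word} (hw : w.efree) : cellCoef (rotAt j c) w = cellCoef c w := by
  rw [cellCoef_rotAt, rotUnit_of_efree (hw j), one_mul]

/-- turning slot `j` multiplies a symmetric row sum by the unit `rotUnit (w j)`. -/
theorem rowSum_eq_rotUnit_mul {U : Finset Cell} (hU : TurnClosed U) {g : Cell → GaussianInt} (hg : TurnInvariantOn U g)
    (j : Fin 4) (w : Word) : rowSum U g w = rotUnit (w j) * rowSum U g w := by
  unfold rowSum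
  calc ∑ c ∈ U, g c * cellCoef c w = ∑ c ∈ U, g (rotAt j c) * cellCoef (rotAt j c) w :=
        (Finset.sum_nbij' (rotAt j) (fun c => rotAt j (rotAt j (rotAt j c))) (fun c hc => hU j c hc)
          (fun c hc => rotAt_three_mem hU j hc) (fun c _ => rotAt_four j c) (fun c _ => rotAt_four j c)
          (fun c _ => rfl)).symm
    _ = ∑ c ∈ U, rotUnit (w j) * (g c * cellCoef c w) :=
        Finset.sum_congr rfl fun c hc => by rw [hg j c hc, cellCoef_rotAt]; ring
    _ = rotUnit (w j) * ∑ c ∈ U, g c * cellCoef c w := (Finset.mul_sum _ _ _).symm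

/-- **SYMMETRY LEMMA, core:** a turn-invariant weight on a turn-closed `U` annihilates the row of every word with an `e`∕`ē` slot. -/
theorem rowSum_eq_zero_of_symmetric {U : Finset Cell} (hU : TurnClosed U) {g : Cell → GaussianInt} (hg : TurnInvariantOn U g)
    {w : Word} {j : Fin 4} (hj : (w j).efree = false) : rowSum U g w = 0 := by
  have key := rowSum_eq_rotUnit_mul hU hg j w
  cases hwj : w j with
  | one => rw [hwj] at hj; exact absurd hj (by decide)
  | h => rw [hwj] at hj; exact absurd hj (by decide)
  | pt => rw [hwj] at hj; exact absurd hj (by decide)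
  | e =>
    rw [hwj] at key
    have hre := congrArg Zsqrtd.re key
    have him := congrArg Zsqrtd.im key
    simp [rotUnit, Zsqrtd.re_mul, Zsqrtd.im_mul] at hre him
    exact Zsqrtd.ext_iff.mpr ⟨by simp; omega, by simp; omega⟩
  | ebar =>
    rw [hwj] at key
    have hre := congrArg Zsqrtd.re key
    have him := congrArg Zsqrtd.im key
    simp [rotUnit, Zsqrtd.re_mul, Zsqrtd.im_mul] at hre him
    exact Zsqrtd.ext_iff.mpr ⟨by simp; omega, by simp; omega⟩

theorem exists_slot_of_not_efree {w : Word} (hw : ¬ w.efree) : ∃ j : Fin 4, (w j).efree = false := by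
  obtain ⟨j, hj⟩ := not_forall.mp hw
  exact ⟨j, by simpa using hj⟩

/-- **SYMMETRY LEMMA in `FinCheck` letter:** a turn-symmetric assignment on a turn-closed `U` satisfies the class-tensor equation `Tfun w = 0`
for EVERY e-mixed word `w` — the (A1).1 rows and also `w = eeee`, `ēēēē`. -/
theorem symmetricPoint_Tfun_eq_zero {U : Finset Cell} (hU : TurnClosed U) {gN gP : Cell → ℕ}
    (hN : ∀ j : Fin 4, ∀ c ∈ U, gN (rotAt j c) = gN c) (hP : ∀ j : Fin 4, ∀ c ∈ U, gP (rotAt j c) = gP c)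
    (w : Word) (hw : ¬ w.efree) : Tfun U gN gP w = 0 := by
  obtain ⟨j, hj⟩ := exists_slot_of_not_efree hw
  have hN' : TurnInvariantOn U (fun c => (gN c : GaussianInt)) := fun j c hc => by simp only [hN j c hc]
  have hP' : TurnInvariantOn U (fun c => (gP c : GaussianInt)) := fun j c hc => by simp only [hP j c hc]
  rw [Tfun_eq_rowSum, rowSum_eq_zero_of_symmetric hU hN' hj, rowSum_eq_zero_of_symmetric hU hP' hj, sub_zero]

/-- (A1).1 holds identically at a symmetric point. -/
theorem symmetricPoint_A1_1 {U : Finset Cell} (hU : TurnClosed U) {gN gP : Cell → ℕ}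
    (hN : ∀ j : Fin 4, ∀ c ∈ U, gN (rotAt j c) = gN c) (hP : ∀ j : Fin 4, ∀ c ∈ U, gP (rotAt j c) = gP c) :
    ∀ w : Word, ¬ w.efree → w ≠ Word.eeee → w ≠ Word.EEEE → Tfun U gN gP w = 0 :=
  fun w hw _ _ => symmetricPoint_Tfun_eq_zero hU hN hP w hw

theorem eeee_not_efree : ¬ Word.eeee.efree := fun h => absurd (h 0) (by decide)

/-- **«the symmetric point has μ = 0».** -/
theorem symmetricPoint_mu_eq_zero {U : Finset Cell} (hU : TurnClosed U) {gN gP : Cell → ℕ}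
    (hN : ∀ j : Fin 4, ∀ c ∈ U, gN (rotAt j c) = gN c) (hP : ∀ j : Fin 4, ∀ c ∈ U, gP (rotAt j c) = gP c) :
    mufun U gN gP = 0 :=
  symmetricPoint_Tfun_eq_zero hU hN hP Word.eeee eeee_not_efree

/-- hence a turn-symmetric assignment on `cellsOn h` never meets the `μ ≠ 0` hypothesis of `FinCheckOn` ∕ a floor witness: every instrument whose
optimum may be taken symmetric (B.1: all rows but (A1).1 type functions) is blind to `μ`. -/
theorem symmetricPoint_not_floor_witness (h : ℤ) {gN gP : Cell → ℕ}
    (hN : ∀ j : Fin 4, ∀ c ∈ cellsOn h, gN (rotAt j c) = gN c) (hP : ∀ j : Fin 4, ∀ c ∈ cellsOn h, gP (rotAt j c) = gP c) :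
    ¬ (mufun (cellsOn h) gN gP ≠ 0) :=
  fun hmu => hmu (symmetricPoint_mu_eq_zero (turnClosed_cellsOn h) hN hP)

/-- DESIGN-LEVEL shadow (from `B4FloorSymmetry.mu_rotD`: a slot turn multiplies `μ` by `−i`): a design whose `μ` is unchanged by turning one
slot — in particular a design carried to itself (as a weighted cell list, up to `T`) by a slot turn — has `μ = 0`. -/
theorem mu_eq_zero_of_mu_rot_invariant (D : Design) (j : Fin 4)
    (h : (Summit.HodgeConjecture.HodgeConjecture.Cruxes.BlochSeedDiscOne.B4FloorSymmetry.mapD (rotAt j) D).mu = D.mu) : D.mu = 0 := by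
  rw [Summit.HodgeConjecture.HodgeConjecture.Cruxes.BlochSeedDiscOne.B4FloorSymmetry.mu_rotD] at h
  have hre := congrArg Zsqrtd.re h
  have him := congrArg Zsqrtd.im h
  simp [Zsqrtd.re_mul, Zsqrtd.im_mul] at hre him
  exact Zsqrtd.ext_iff.mpr ⟨by simp; omega, by simp; omega⟩

end symmetry

/-! ### §6.2 the «(≥)» half (v2.2): TORUS SYMMETRISATION — every assignment has a symmetric companion with the same type-function data

The full torus `(ℤ∕4)⁴` acts by `DepthBoundA4.rotCell k` (slotwise `rotPow`); `torusSum g c := Σ_k g (rotCell k c)` is the orbit SUM of `g` (the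
uniform-on-types lift × 256, kept integral). On a torus-closed `U` (e.g. `cellsOn h`): `torusSum g` is invariant under every slot turn (hence, by §6,
satisfies all (A1).1 rows and has `μ = 0`), multiplies every e-free row, the copy count and the rank by `256 = |(ℤ∕4)⁴|`, preserves (A4) and preserves the
presence of floor letters in both directions. So dropping the (A1).1 rows (and `μ`) from any programme whose other rows are type functions cannot change
feasibility up to scaling — B.1 in kernel form for integer points (LP optimality itself is not typed). Relation to the tree: `DepthBoundA4.A1_mixed_automatic`
is the `S₀`-invariant DESIGN version ((A1).1 automatic under the μ-preserving subgroup `S₀ = {Σ k_f ≡ 0 (4)}`, which keeps `μ` alive); here the FULL torus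
acts, under which `μ` dies too (`symmetricPoint_mu_eq_zero`), in `FinCheck` function form relative to `U`; `DepthBoundA4.linG_rot` is the design-level
re-indexing identity of which `rowSum_eq_rotUnit_mul` is the `U`-relative single-slot case. -/

section symmetrisation
open Summit.HodgeConjecture.HodgeConjecture.Cruxes.BlochSeedDiscOne.B4FloorSymmetry (rotAt rotAt_self rotAt_of_ne onAlphabet_rotI ampleAbove_rotI)

/-- `U` is closed under the full torus. -/
def TorusClosed (U : Finset Cell) : Prop := ∀ k : Fin 4 → Fin 4, ∀ c ∈ U, rotCell k c ∈ U

theorem onAlphabet_rotPow (h : ℤ) (n : ℕ) (ℓ : Letter) : (ℓ.rotPow n).OnAlphabet h ↔ ℓ.OnAlphabet h := by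
  induction n generalizing ℓ with
  | zero => exact Iff.rfl
  | succ n ih => rw [rotPow_succ, ih, onAlphabet_rotI]

theorem ampleAbove_rotPow (n : ℕ) (ℓ ℓ' : Letter) : AmpleAbove (ℓ.rotPow n) (ℓ'.rotPow n) ↔ AmpleAbove ℓ ℓ' := by
  induction n generalizing ℓ ℓ' with
  | zero => exact Iff.rfl
  | succ n ih => rw [rotPow_succ, rotPow_succ, ih, ampleAbove_rotI]

theorem torusClosed_cellsOn (h : ℤ) : TorusClosed (cellsOn h) := fun k c hc =>
  mem_cellsOn.mpr fun f => (onAlphabet_rotPow h (k f).val (c f)).mpr (mem_cellsOn.mp hc f)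

theorem live_rotCell (k : Fin 4 → Fin 4) (x y : Cell) : Live (rotCell k x) (rotCell k y) ↔ Live x y :=
  forall_congr' fun f => ampleAbove_rotPow (k f).val (x f) (y f)

theorem rotCell_a (k : Fin 4 → Fin 4) (c : Cell) (f : Fin 4) : (rotCell k c f).a = (c f).a := rotPow_a _ _

/-- the torus action is an action: `rotCell k ∘ rotCell k' = rotCell (k + k')`. -/
theorem rotCell_add (k k' : Fin 4 → Fin 4) (c : Cell) : rotCell k (rotCell k' c) = rotCell (k + k') c := by
  funext f
  show ((c f).rotPow (k' f).val).rotPow (k f).val = (c f).rotPow ((k + k') f).val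
  rw [rotPow_add, Pi.add_apply, Fin.val_add, ← rotPow_mod4]

theorem rotCell_zero (c : Cell) : rotCell 0 c = c := funext fun _ => rfl

/-- a single slot turn is the torus element `Pi.single j 1`. -/
theorem rotAt_eq_rotCell (j : Fin 4) (c : Cell) : rotAt j c = rotCell (Pi.single j 1) c := by
  funext f
  by_cases hf : f = j
  · subst hf
    rw [rotAt_self]
    show (c f).rotI = (c f).rotPow (Pi.single (M := fun _ : Fin 4 => Fin 4) f 1 f).val
    rw [Pi.single_eq_same]
    rfl
  · rw [rotAt_of_ne hf]
    show c f = (c f).rotPow (Pi.single (M := fun _ : Fin 4 => Fin 4) j 1 f).val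
    rw [Pi.single_eq_of_ne hf]
    rfl

/-- the ORBIT SUM of a weight under the full torus (the uniform-on-types lift, times `256`). -/
def torusSum (g : Cell → ℕ) (c : Cell) : ℕ := ∑ k : Fin 4 → Fin 4, g (rotCell k c)

/-- the orbit sum is torus-invariant … -/
theorem torusSum_rotCell (g : Cell → ℕ) (k' : Fin 4 → Fin 4) (c : Cell) : torusSum g (rotCell k' c) = torusSum g c := by
  unfold torusSum
  simp_rw [rotCell_add]
  exact Fintype.sum_equiv (Equiv.addRight k') _ _ fun k => rfl

/-- … in particular invariant under every slot turn (hypothesis shape of §6). -/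
theorem torusSum_rotAt (g : Cell → ℕ) (j : Fin 4) (c : Cell) : torusSum g (rotAt j c) = torusSum g c := by
  rw [rotAt_eq_rotCell, torusSum_rotCell]

theorem le_torusSum (g : Cell → ℕ) (k : Fin 4 → Fin 4) (c : Cell) : g (rotCell k c) ≤ torusSum g c :=
  Finset.single_le_sum (f := fun k => g (rotCell k c)) (fun _ _ => Nat.zero_le _) (Finset.mem_univ k)

theorem self_le_torusSum (g : Cell → ℕ) (c : Cell) : g c ≤ torusSum g c := by
  have h := le_torusSum g 0 c
  rwa [rotCell_zero] at h

theorem exists_pos_of_torusSum_pos {g : Cell → ℕ} {c : Cell} (h : 0 < torusSum g c) : ∃ k : Fin 4 → Fin 4, 0 < g (rotCell k c) := by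
  by_contra hne
  simp only [not_exists, not_lt, Nat.le_zero] at hne
  unfold torusSum at h
  rw [Finset.sum_eq_zero (fun k _ => hne k)] at h
  exact lt_irrefl 0 h

/-- RE-INDEXING: on a torus-closed `U`, summing the orbit sum against a torus-invariant test function multiplies by `256`. -/
theorem sum_torusSum_mul {R : Type*} [CommSemiring R] {U : Finset Cell} (hU : TorusClosed U) (g : Cell → ℕ) (φ : Cell → R)
    (hφ : ∀ k : Fin 4 → Fin 4, ∀ c ∈ U, φ (rotCell k c) = φ c) :
    ∑ c ∈ U, (torusSum g c : R) * φ c = 256 * ∑ c ∈ U, (g c : R) * φ c := by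
  unfold torusSum
  simp_rw [Nat.cast_sum, Finset.sum_mul]
  rw [Finset.sum_comm]
  have inner : ∀ k : Fin 4 → Fin 4, ∑ c ∈ U, (g (rotCell k c) : R) * φ c = ∑ c ∈ U, (g c : R) * φ c := fun k =>
    Finset.sum_nbij' (fun c => rotCell k c) (fun c => rotCell (k3 k) c) (fun c hc => hU k c hc) (fun c hc => hU _ c hc)
      (fun c _ => rotCell_k3_left k c) (fun c _ => rotCell_k3_right k c) (fun c hc => by rw [hφ k c hc])
  simp_rw [inner]
  rw [Finset.sum_const, Finset.card_univ, Fintype.card_fun, Fintype.card_fin, nsmul_eq_mul]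
  norm_num

theorem rotPhase_of_efree {w : Word} (hw : w.efree) (k : Fin 4 → Fin 4) : w.rotPhase k = 1 :=
  Finset.prod_eq_one fun f _ => by rw [(phase_eq_one_iff _).mpr (hw f), one_pow]

/-- e-free rows of the orbit sum = `256 ×` the e-free rows of `g`. -/
theorem rowSum_torusSum_efree {U : Finset Cell} (hU : TorusClosed U) (g : Cell → ℕ) {w : Word} (hw : w.efree) :
    rowSum U (fun c => (torusSum g c : GaussianInt)) w = 256 * rowSum U (fun c => (g c : GaussianInt)) w :=
  sum_torusSum_mul hU g (fun c => cellCoef c w) fun k c _ => by rw [cellCoef_rotCell_phase, rotPhase_of_efree hw, one_mul]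

theorem Tfun_torusSum_efree {U : Finset Cell} (hU : TorusClosed U) (gN gP : Cell → ℕ) {w : Word} (hw : w.efree) :
    Tfun U (torusSum gN) (torusSum gP) w = 256 * Tfun U gN gP w := by
  rw [Tfun_eq_rowSum, Tfun_eq_rowSum, rowSum_torusSum_efree hU gN hw, rowSum_torusSum_efree hU gP hw, mul_sub]

theorem copiesfun_torusSum {U : Finset Cell} (hU : TorusClosed U) (gN gP : Cell → ℕ) :
    copiesfun U (torusSum gN) (torusSum gP) = 256 * copiesfun U gN gP := by
  have h1 := sum_torusSum_mul (R := ℕ) hU gN (fun _ => 1) (fun _ _ _ => rfl)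
  have h2 := sum_torusSum_mul (R := ℕ) hU gP (fun _ => 1) (fun _ _ _ => rfl)
  simp only [Nat.cast_id, mul_one] at h1 h2
  unfold copiesfun
  rw [h1, h2]; ring

theorem rankfun_torusSum {U : Finset Cell} (hU : TorusClosed U) (gN gP : Cell → ℕ) :
    rankfun U (torusSum gN) (torusSum gP) = 256 * rankfun U gN gP := by
  have h1 := sum_torusSum_mul (R := ℤ) hU gN (fun _ => 1) (fun _ _ _ => rfl)
  have h2 := sum_torusSum_mul (R := ℤ) hU gP (fun _ => 1) (fun _ _ _ => rfl)
  simp only [mul_one] at h1 h2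
  unfold rankfun
  rw [h1, h2]; ring

/-- (A4) survives symmetrisation. -/
theorem A4fun_torusSum {U : Finset Cell} (hU : TorusClosed U) {gN gP : Cell → ℕ} (h4 : A4fun U gN gP) :
    A4fun U (torusSum gN) (torusSum gP) := by
  refine ⟨fun x hx hpos => ?_, fun y hy hpos => ?_⟩
  · obtain ⟨k, hk⟩ := exists_pos_of_torusSum_pos hpos
    obtain ⟨y, hyU, hyN, hl⟩ := h4.1 (rotCell k x) (hU k x hx) hk
    have hl' := (live_rotCell (k3 k) _ _).mpr hl
    rw [rotCell_k3_left] at hl'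
    refine ⟨rotCell (k3 k) y, hU _ y hyU, lt_of_lt_of_le ?_ (le_torusSum gN k _), hl'⟩
    rwa [rotCell_k3_right]
  · obtain ⟨k, hk⟩ := exists_pos_of_torusSum_pos hpos
    obtain ⟨x, hxU, hxP, hl⟩ := h4.2 (rotCell k y) (hU k y hy) hk
    have hl' := (live_rotCell (k3 k) _ _).mpr hl
    rw [rotCell_k3_left] at hl'
    refine ⟨rotCell (k3 k) x, hU _ x hxU, lt_of_lt_of_le ?_ (le_torusSum gP k _), hl'⟩
    rwa [rotCell_k3_right]

/-- floor letters are present after symmetrisation iff before. -/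
theorem noFloor_torusSum_iff {U : Finset Cell} (hU : TorusClosed U) (gN gP : Cell → ℕ) :
    NoFloor U (torusSum gN) (torusSum gP) ↔ NoFloor U gN gP := by
  constructor
  · intro h c hc hpos f
    exact h c hc (lt_of_lt_of_le hpos (Nat.add_le_add (self_le_torusSum gN c) (self_le_torusSum gP c))) f
  · intro h c hc hpos f
    rcases Nat.lt_or_ge 0 (torusSum gN c) with hN | hN
    · obtain ⟨k, hk⟩ := exists_pos_of_torusSum_pos hN
      have := h (rotCell k c) (hU k c hc) (lt_of_lt_of_le hk (Nat.le_add_right _ _)) f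
      rwa [rotCell_a] at this
    · have hP : 0 < torusSum gP c := by omega
      obtain ⟨k, hk⟩ := exists_pos_of_torusSum_pos hP
      have := h (rotCell k c) (hU k c hc) (lt_of_lt_of_le hk (Nat.le_add_left _ _)) f
      rwa [rotCell_a] at this

/-- (A1) survives symmetrisation — in fact only the e-free half (A1).2 of `g` is used; (A1).1 of the orbit sum is automatic (§6). -/
theorem A1fun_torusSum {U : Finset Cell} (hU : TorusClosed U) (hU' : TurnClosed U) {gN gP : Cell → ℕ}
    (h12 : ∀ w w' : Word, w.efree → w'.efree → w.deg = w'.deg → Tfun U gN gP w = Tfun U gN gP w') :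
    A1fun U (torusSum gN) (torusSum gP) :=
  ⟨symmetricPoint_A1_1 hU' (fun j c _ => torusSum_rotAt gN j c) (fun j c _ => torusSum_rotAt gP j c),
    fun w w' hw hw' hd => by rw [Tfun_torusSum_efree hU gN gP hw, Tfun_torusSum_efree hU gN gP hw', h12 w w' hw hw' hd]⟩

/-- **B.1 FOR INTEGER POINTS on `cellsOn h` (the symmetrisation theorem).** For every assignment `(gN, gP)` the orbit sums `(ĝN, ĝP)` form a
turn-symmetric assignment with: `μ = 0` and all (A1).1 rows; every e-free row, the copy count and the rank multiplied by `256`; (A4) preserved;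
floor letters present iff before; (A1) as soon as `g` has (A1).2. Hence no instrument whose constraints other than (A1).1 ∕ `μ ≠ 0` are type
functions (invariant under the torus, homogeneous) separates `g` from a `μ = 0` point. -/
theorem torus_symmetrisation (h : ℤ) (gN gP : Cell → ℕ) :
    mufun (cellsOn h) (torusSum gN) (torusSum gP) = 0 ∧
    (∀ w : Word, ¬ w.efree → Tfun (cellsOn h) (torusSum gN) (torusSum gP) w = 0) ∧
    (∀ w : Word, w.efree → Tfun (cellsOn h) (torusSum gN) (torusSum gP) w = 256 * Tfun (cellsOn h) gN gP w) ∧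
    copiesfun (cellsOn h) (torusSum gN) (torusSum gP) = 256 * copiesfun (cellsOn h) gN gP ∧
    rankfun (cellsOn h) (torusSum gN) (torusSum gP) = 256 * rankfun (cellsOn h) gN gP ∧
    (A4fun (cellsOn h) gN gP → A4fun (cellsOn h) (torusSum gN) (torusSum gP)) ∧
    (NoFloor (cellsOn h) (torusSum gN) (torusSum gP) ↔ NoFloor (cellsOn h) gN gP) :=
  ⟨symmetricPoint_mu_eq_zero (turnClosed_cellsOn h) (fun j c _ => torusSum_rotAt gN j c) (fun j c _ => torusSum_rotAt gP j c),
    fun w hw => symmetricPoint_Tfun_eq_zero (turnClosed_cellsOn h) (fun j c _ => torusSum_rotAt gN j c)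
      (fun j c _ => torusSum_rotAt gP j c) w hw,
    fun _ hw => Tfun_torusSum_efree (torusClosed_cellsOn h) gN gP hw,
    copiesfun_torusSum (torusClosed_cellsOn h) gN gP, rankfun_torusSum (torusClosed_cellsOn h) gN gP,
    A4fun_torusSum (torusClosed_cellsOn h), noFloor_torusSum_iff (torusClosed_cellsOn h) gN gP⟩

/-! ### §6.3 (v2.4) FLIP SYMMETRISATION — the `{±1}⁴` subgroup of the torus (negation g18, bus l.10516, LEMMA (1), in kernel form)

The sixteen slotwise SIGN FLIPS `(a;x,y) ↦ (a;−x,−y)` (a HALF turn `rotPow 2` at each slot of a pattern `s : Fin 4 → Bool`) form the subgroup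
`{0,2}⁴ ≅ {±1}⁴` of the torus `(ℤ∕4)⁴`. The orbit sum `flipSum g c := Σ_s g (rotCell (dbl s) c)` (masses copied to the 16 images) satisfies, on any
torus-closed `U` (e.g. `cellsOn h`): EVERY row of a word with an `e` or `ē` slot vanishes — `Tfun U (flipSum gN) (flipSum gP) w = flipChar w · Tfun U gN gP w`
with the FLIP CHARACTER `flipChar w = Σ_s ρ(w, dbl s) = ∏_f (phase(w_f)² + 1)` = `16` on e-free words and `0` as soon as one slot carries `e`/`ē`
(`phase² = −1`); so `μ = 0`, (A1).1 outright, every e-free row × 16 (hence (A1).2 inherited), copies and rank × 16, (A4) preserved (partners flip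
together: `live_rotCell`), floor letters present iff before. Compared with §6.2 (full torus, factor 256) the factor is `16`; negation's pen remark that 16 is
the least order of a subgroup of slot turns killing all mixed words of an H-free cell is NOT typed here. Use (negation §(1) COROLLARY): an integer
point of a cap-free class system with the right granularity letters to a flip-symmetric (A1) ∧ (A4) assignment with `μ = 0`. -/

/-- the torus element of a flip pattern: a half turn (`2`) at the slots where `s` is `true`, nothing elsewhere. -/
def dbl (s : Fin 4 → Bool) : Fin 4 → Fin 4 := fun f => bif s f then 2 else 0

theorem dbl_add_dbl (s : Fin 4 → Bool) : dbl s + dbl s = 0 := by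
  funext f
  simp only [dbl, Pi.add_apply, Pi.zero_apply]
  cases s f <;> decide

/-- flips are involutions. -/
theorem rotCell_dbl_dbl (s : Fin 4 → Bool) (c : Cell) : rotCell (dbl s) (rotCell (dbl s) c) = c := by
  rw [rotCell_add, dbl_add_dbl, rotCell_zero]

/-- reading check: the flip at slots 0 and 2 negates `x` and `y` there and fixes slots 1 and 3. -/
example : rotCell (dbl ![true, false, true, false]) ![⟨2, 1, 1⟩, ⟨2, 1, 1⟩, ⟨0, 3, -1⟩, ⟨1, 0, 2⟩]
    = ![⟨2, -1, -1⟩, ⟨2, 1, 1⟩, ⟨0, -3, 1⟩, ⟨1, 0, 2⟩] := by decide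

/-- the FLIP SUM of a weight: its orbit sum under the sixteen slotwise sign flips (masses copied to the 16 images). -/
def flipSum (g : Cell → ℕ) (c : Cell) : ℕ := ∑ s : Fin 4 → Bool, g (rotCell (dbl s) c)

theorem le_flipSum (g : Cell → ℕ) (s : Fin 4 → Bool) (c : Cell) : g (rotCell (dbl s) c) ≤ flipSum g c :=
  Finset.single_le_sum (f := fun s => g (rotCell (dbl s) c)) (fun _ _ => Nat.zero_le _) (Finset.mem_univ s)

theorem dbl_false : dbl (fun _ => false) = 0 := rfl

theorem self_le_flipSum (g : Cell → ℕ) (c : Cell) : g c ≤ flipSum g c := by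
  have h := le_flipSum g (fun _ => false) c
  rwa [dbl_false, rotCell_zero] at h

theorem exists_pos_of_flipSum_pos {g : Cell → ℕ} {c : Cell} (h : 0 < flipSum g c) : ∃ s : Fin 4 → Bool, 0 < g (rotCell (dbl s) c) := by
  by_contra hne
  simp only [not_exists, not_lt, Nat.le_zero] at hne
  unfold flipSum at h
  rw [Finset.sum_eq_zero (fun s _ => hne s)] at h
  exact lt_irrefl 0 h

/-- RE-INDEXING: on a torus-closed `U`, pairing the flip sum with any test function = summing the test function over the 16 flips. -/
theorem sum_flipSum_mul {R : Type*} [CommSemiring R] {U : Finset Cell} (hU : TorusClosed U) (g : Cell → ℕ) (φ : Cell → R) :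
    ∑ c ∈ U, (flipSum g c : R) * φ c = ∑ s : Fin 4 → Bool, ∑ c ∈ U, (g c : R) * φ (rotCell (dbl s) c) := by
  unfold flipSum
  simp_rw [Nat.cast_sum, Finset.sum_mul]
  rw [Finset.sum_comm]
  refine Finset.sum_congr rfl fun s _ => ?_
  exact Finset.sum_nbij' (fun c => rotCell (dbl s) c) (fun c => rotCell (dbl s) c) (fun c hc => hU _ c hc) (fun c hc => hU _ c hc)
    (fun c _ => rotCell_dbl_dbl s c) (fun c _ => rotCell_dbl_dbl s c) (fun c _ => by rw [rotCell_dbl_dbl])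

/-- the FLIP CHARACTER of a word: the total phase `Σ_s ρ(w, dbl s)` picked up over the 16 flips. -/
def flipChar (w : Word) : GaussianInt := ∑ s : Fin 4 → Bool, w.rotPhase (dbl s)

/-- product formula `flipChar w = ∏_f (phase(w_f)² + 1)`. -/
theorem flipChar_eq_prod (w : Word) : flipChar w = ∏ f : Fin 4, ((w f).phase ^ 2 + 1) := by
  symm
  calc ∏ f : Fin 4, ((w f).phase ^ 2 + 1)
      = ∏ f : Fin 4, ∑ b : Bool, (w f).phase ^ (bif b then (2 : Fin 4) else 0).val :=
        Finset.prod_congr rfl fun f _ => by rw [Fintype.sum_bool]; simp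
    _ = ∑ s : Fin 4 → Bool, ∏ f : Fin 4, (w f).phase ^ (bif s f then (2 : Fin 4) else 0).val :=
        Fintype.prod_sum (fun f b => (w f).phase ^ (bif b then (2 : Fin 4) else 0).val)
    _ = flipChar w := rfl

/-- `phase² + 1` is `2` on an e-free symbol and `0` on `e`, `ē` (`(∓i)² = −1`). -/
theorem phase_sq_add_one (σ : Sym) : σ.phase ^ 2 + 1 = if σ.efree = true then 2 else 0 := by
  cases σ <;> decide

theorem flipChar_of_efree {w : Word} (hw : w.efree) : flipChar w = 16 := by
  rw [flipChar_eq_prod, Finset.prod_congr rfl fun f _ => by rw [phase_sq_add_one, if_pos (hw f)]]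
  rw [Finset.prod_const, Finset.card_univ, Fintype.card_fin]
  norm_num

/-- every word with an `e` or `ē` slot has flip character `0`. -/
theorem flipChar_of_not_efree {w : Word} (hw : ¬ w.efree) : flipChar w = 0 := by
  obtain ⟨f, hf⟩ := not_forall.mp hw
  rw [flipChar_eq_prod]
  exact Finset.prod_eq_zero (Finset.mem_univ f) (by rw [phase_sq_add_one, if_neg hf])

/-- rows of the flip sum = flip character × rows. -/
theorem rowSum_flipSum {U : Finset Cell} (hU : TorusClosed U) (g : Cell → ℕ) (w : Word) :
    rowSum U (fun c => (flipSum g c : GaussianInt)) w = flipChar w * rowSum U (fun c => (g c : GaussianInt)) w := by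
  show ∑ c ∈ U, (flipSum g c : GaussianInt) * cellCoef c w = flipChar w * ∑ c ∈ U, (g c : GaussianInt) * cellCoef c w
  rw [sum_flipSum_mul hU g (fun c => cellCoef c w)]
  simp_rw [cellCoef_rotCell_phase]
  unfold flipChar
  rw [Finset.sum_mul]
  refine Finset.sum_congr rfl fun s _ => ?_
  rw [Finset.mul_sum]
  exact Finset.sum_congr rfl fun c _ => by ring

theorem Tfun_flipSum {U : Finset Cell} (hU : TorusClosed U) (gN gP : Cell → ℕ) (w : Word) :
    Tfun U (flipSum gN) (flipSum gP) w = flipChar w * Tfun U gN gP w := by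
  rw [Tfun_eq_rowSum, Tfun_eq_rowSum, rowSum_flipSum hU gN w, rowSum_flipSum hU gP w, mul_sub]

/-- **every row of a word with an `e` or `ē` slot vanishes on the flip sum** — all (A1).1 rows AND `μ` (and `T ēēēē`), at every assignment `g`. -/
theorem Tfun_flipSum_not_efree {U : Finset Cell} (hU : TorusClosed U) (gN gP : Cell → ℕ) {w : Word} (hw : ¬ w.efree) :
    Tfun U (flipSum gN) (flipSum gP) w = 0 := by
  rw [Tfun_flipSum hU, flipChar_of_not_efree hw, zero_mul]

/-- e-free rows of the flip sum = `16 ×` the e-free rows. -/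
theorem Tfun_flipSum_efree {U : Finset Cell} (hU : TorusClosed U) (gN gP : Cell → ℕ) {w : Word} (hw : w.efree) :
    Tfun U (flipSum gN) (flipSum gP) w = 16 * Tfun U gN gP w := by
  rw [Tfun_flipSum hU, flipChar_of_efree hw]

theorem mufun_flipSum {U : Finset Cell} (hU : TorusClosed U) (gN gP : Cell → ℕ) : mufun U (flipSum gN) (flipSum gP) = 0 :=
  Tfun_flipSum_not_efree hU gN gP eeee_not_efree

theorem copiesfun_flipSum {U : Finset Cell} (hU : TorusClosed U) (gN gP : Cell → ℕ) :
    copiesfun U (flipSum gN) (flipSum gP) = 16 * copiesfun U gN gP := by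
  have h1 := sum_flipSum_mul (R := ℕ) hU gN (fun _ => 1)
  have h2 := sum_flipSum_mul (R := ℕ) hU gP (fun _ => 1)
  simp only [Nat.cast_id, mul_one, Finset.sum_const, Finset.card_univ, Fintype.card_fun, Fintype.card_bool, Fintype.card_fin,
    smul_eq_mul] at h1 h2
  unfold copiesfun
  rw [h1, h2]; ring

theorem rankfun_flipSum {U : Finset Cell} (hU : TorusClosed U) (gN gP : Cell → ℕ) :
    rankfun U (flipSum gN) (flipSum gP) = 16 * rankfun U gN gP := by
  have h1 := sum_flipSum_mul (R := ℤ) hU gN (fun _ => 1)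
  have h2 := sum_flipSum_mul (R := ℤ) hU gP (fun _ => 1)
  simp only [mul_one, Finset.sum_const, Finset.card_univ, Fintype.card_fun, Fintype.card_bool, Fintype.card_fin] at h1 h2
  unfold rankfun
  rw [h1, h2]; ring

/-- (A4) survives flip symmetrisation (partners flip together). -/
theorem A4fun_flipSum {U : Finset Cell} (hU : TorusClosed U) {gN gP : Cell → ℕ} (h4 : A4fun U gN gP) :
    A4fun U (flipSum gN) (flipSum gP) := by
  refine ⟨fun x hx hpos => ?_, fun y hy hpos => ?_⟩
  · obtain ⟨s, hs⟩ := exists_pos_of_flipSum_pos hpos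
    obtain ⟨y, hyU, hyN, hl⟩ := h4.1 (rotCell (dbl s) x) (hU _ x hx) hs
    rw [← rotCell_dbl_dbl s y, live_rotCell] at hl
    exact ⟨rotCell (dbl s) y, hU _ y hyU, lt_of_lt_of_le (by rwa [rotCell_dbl_dbl]) (le_flipSum gN s _), hl⟩
  · obtain ⟨s, hs⟩ := exists_pos_of_flipSum_pos hpos
    obtain ⟨x, hxU, hxP, hl⟩ := h4.2 (rotCell (dbl s) y) (hU _ y hy) hs
    rw [← rotCell_dbl_dbl s x, live_rotCell] at hl
    exact ⟨rotCell (dbl s) x, hU _ x hxU, lt_of_lt_of_le (by rwa [rotCell_dbl_dbl]) (le_flipSum gP s _), hl⟩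

/-- floor letters are present after flip symmetrisation iff before. -/
theorem noFloor_flipSum_iff {U : Finset Cell} (hU : TorusClosed U) (gN gP : Cell → ℕ) :
    NoFloor U (flipSum gN) (flipSum gP) ↔ NoFloor U gN gP := by
  constructor
  · intro h c hc hpos f
    exact h c hc (lt_of_lt_of_le hpos (Nat.add_le_add (self_le_flipSum gN c) (self_le_flipSum gP c))) f
  · intro h c hc hpos f
    rcases Nat.lt_or_ge 0 (flipSum gN c) with hN | hN
    · obtain ⟨s, hs⟩ := exists_pos_of_flipSum_pos hN
      have := h (rotCell (dbl s) c) (hU _ c hc) (lt_of_lt_of_le hs (Nat.le_add_right _ _)) f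
      rwa [rotCell_a] at this
    · have hP : 0 < flipSum gP c := by omega
      obtain ⟨s, hs⟩ := exists_pos_of_flipSum_pos hP
      have := h (rotCell (dbl s) c) (hU _ c hc) (lt_of_lt_of_le hs (Nat.le_add_left _ _)) f
      rwa [rotCell_a] at this

/-- (A1) of the flip sum from (A1).2 of `g` alone — (A1).1 is automatic. -/
theorem A1fun_flipSum {U : Finset Cell} (hU : TorusClosed U) {gN gP : Cell → ℕ}
    (h12 : ∀ w w' : Word, w.efree → w'.efree → w.deg = w'.deg → Tfun U gN gP w = Tfun U gN gP w') :
    A1fun U (flipSum gN) (flipSum gP) :=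
  ⟨fun w hw _ _ => Tfun_flipSum_not_efree hU gN gP hw,
    fun w w' hw hw' hd => by rw [Tfun_flipSum_efree hU gN gP hw, Tfun_flipSum_efree hU gN gP hw', h12 w w' hw hw' hd]⟩

/-- **FLIP SYMMETRISATION on `cellsOn h`** (negation g18 LEMMA (1)). For every assignment `(gN, gP)` the flip sums `(g♭N, g♭P)` satisfy: `μ = 0`; every
row of a word with an `e`∕`ē` slot is `0` ((A1).1 outright); every e-free row, the copy count and the rank are multiplied by `16`; (A4) is preserved;
floor letters are present iff before; (A1) holds as soon as `g` has (A1).2. -/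
theorem flip_symmetrisation (h : ℤ) (gN gP : Cell → ℕ) :
    mufun (cellsOn h) (flipSum gN) (flipSum gP) = 0 ∧
    (∀ w : Word, ¬ w.efree → Tfun (cellsOn h) (flipSum gN) (flipSum gP) w = 0) ∧
    (∀ w : Word, w.efree → Tfun (cellsOn h) (flipSum gN) (flipSum gP) w = 16 * Tfun (cellsOn h) gN gP w) ∧
    copiesfun (cellsOn h) (flipSum gN) (flipSum gP) = 16 * copiesfun (cellsOn h) gN gP ∧
    rankfun (cellsOn h) (flipSum gN) (flipSum gP) = 16 * rankfun (cellsOn h) gN gP ∧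
    (A4fun (cellsOn h) gN gP → A4fun (cellsOn h) (flipSum gN) (flipSum gP)) ∧
    (NoFloor (cellsOn h) (flipSum gN) (flipSum gP) ↔ NoFloor (cellsOn h) gN gP) ∧
    ((∀ w w' : Word, w.efree → w'.efree → w.deg = w'.deg → Tfun (cellsOn h) gN gP w = Tfun (cellsOn h) gN gP w') →
      A1fun (cellsOn h) (flipSum gN) (flipSum gP)) :=
  ⟨mufun_flipSum (torusClosed_cellsOn h) gN gP, fun _ hw => Tfun_flipSum_not_efree (torusClosed_cellsOn h) gN gP hw,
    fun _ hw => Tfun_flipSum_efree (torusClosed_cellsOn h) gN gP hw, copiesfun_flipSum (torusClosed_cellsOn h) gN gP,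
    rankfun_flipSum (torusClosed_cellsOn h) gN gP, A4fun_flipSum (torusClosed_cellsOn h), noFloor_flipSum_iff (torusClosed_cellsOn h) gN gP,
    A1fun_flipSum (torusClosed_cellsOn h)⟩

end symmetrisation

/-! ## §7 LEVEL 1.5 (v2.3; director-hodge R19.527 (1) TYPIST ORDER): ORBIT-SUMMED |E| = 1 ROWS ON LETTER MARGINALS, and the PER-LETTER COVER LAW

The objects of joint memo §C (gs-eng-2) ∕ CIBB-1.5 PREREG (bus l.10450): an INCIDENCE is a pair (cell `c`, active slot `f`); its KEY `[τ, σ, ℓ]` is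
(multiset type `τ = shapeMS c`, active letter `ℓ = c f`; `σ = shape ℓ`); the LETTER MARGINAL `y_g[τ,σ,ℓ]` of a weight `g : Cell → ℕ` on a cell set
`U` is the number of incidences of `U` with that key, counted with multiplicity (`marg`). (a) For a passive filling `φ : Fin 3 → {1, h, pt}` the
S₄-orbit of the word `e ⊗ φ` consists of the words `eWord f (φ ∘ π)` (`e` at slot `f`, `φ` placed by `π` on the other three slots in increasing
order); `orbitRowE1 U gN gP φ := Σ_f Σ_{π ∈ S₃} Tfun (eWord f (φ ∘ π))` counts each distinct word `|Stab_{S₃} φ|` times (1, 2 or 6) — CIBB's row is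
`orbitRowE1 ∕ |Stab φ|`, the same `= 0` row. VALIDITY (`orbitRowE1_eq_zero`) uses (A1).1 ONLY and holds at EVERY integer assignment: no
symmetrisation of the DESIGN (§6's B.1 lemma is about symmetric points and is not used here); what is symmetrised is the ROW. MARGINAL FORM
(`orbitRowE1_eq_marginal`): `cellCoef c (eWord f ψ) = conj β(c f) · Π_j coef ψ_j (passive letter j)` (`cellCoef_eWord`), the passive sum over
placements `V3 φ` sees only the profiles `(a, n)` of the passive letters (`V3_congr_prof`) and is symmetric in them (`V3_perm`), and two incidences
with the same key have passive triples with equal profile multisets (`pass_prof_perm_of_key_eq`, via the bookkeeping `exists_perm_of_map_univ_eq`),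
so the incidence coefficient factors through the key (`incidenceCoef_eq_of_key_eq`, table `keyCoef`, `keyCoef_key`) and the row regroups fiberwise
(`sum_incid_eq_sum_keys`) into `Σ_k keyCoef φ k · (y_N[k] − y_P[k])` — `orbitRowE1_marginal_sound`: this vanishes at every (A1) assignment.
(b) The per-letter cover disjunction (Dy) «`y_N[τ,σ,ℓ] = 0 ∨ Σ{y_P[π,σ',ℓ'] : π ∈ Cov(τ), ℓ' amply below ℓ} ≥ 1`» (and its dual) is (A4) + «present ⇒
mass ≥ 1» read through ANY key map and ANY relation on keys that shadows `Live` slot by slot (`letterCoverRows_of_A4fun`); instances: the active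
letters alone (`coverRowsLetter_of_A4fun`), active letter + `Cov` (`coverRowsLetterCov_of_A4fun`, `CovMS` = realised `⊲_S`), support form
`coverClosedLetter_of_A4`. As in §1.4 the target sets ignore slot-consistency beyond the active slot — relaxations of (A4), hence sound.
NOT a floor, not a design, not a certificate: LP rows remain pen∕solver objects; what is kernel-checked is that every integer (A1) ∧ (A4) point
satisfies them. -/

section level15

/-! ### §7.1 |E| = 1 words, their S₄-orbit sums, validity at EVERY (A1) assignment -/

/-- the |E| = 1 word with `e` at the ACTIVE slot `f` and the filling `ψ` on the three PASSIVE slots (in increasing slot order). -/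
def eWord (f : Fin 4) (ψ : Fin 3 → Sym) : Word := Fin.insertNth (α := fun _ : Fin 4 => Sym) f Sym.e ψ

theorem eWord_self (f : Fin 4) (ψ : Fin 3 → Sym) : eWord f ψ f = Sym.e :=
  Fin.insertNth_apply_same (α := fun _ : Fin 4 => Sym) f Sym.e ψ

theorem eWord_succAbove (f : Fin 4) (ψ : Fin 3 → Sym) (j : Fin 3) : eWord f ψ (f.succAbove j) = ψ j :=
  Fin.insertNth_apply_succAbove (α := fun _ : Fin 4 => Sym) f Sym.e ψ j

theorem eWord_not_efree (f : Fin 4) (ψ : Fin 3 → Sym) : ¬ (eWord f ψ).efree := fun h => by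
  have h1 := h f
  rw [eWord_self] at h1
  exact absurd h1 (by decide)

theorem eWord_ne_eeee (f : Fin 4) {ψ : Fin 3 → Sym} (hψ : ∀ j, (ψ j).efree = true) : eWord f ψ ≠ Word.eeee := fun h => by
  have h0 := congrFun h (f.succAbove 0)
  rw [eWord_succAbove] at h0
  change ψ 0 = Sym.e at h0
  have h1 := hψ 0
  rw [h0] at h1
  exact absurd h1 (by decide)

theorem eWord_ne_EEEE (f : Fin 4) (ψ : Fin 3 → Sym) : eWord f ψ ≠ Word.EEEE := fun h => by
  have h0 := congrFun h f
  rw [eWord_self] at h0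
  change Sym.e = Sym.ebar at h0
  exact absurd h0 (by decide)

/-- reading check: `e` at slot 1 and the filling `(1, h, pt)` on slots 0, 2, 3 in increasing order; `e` at slot 3. -/
example : eWord 1 ![Sym.one, Sym.h, Sym.pt] = ![Sym.one, Sym.e, Sym.h, Sym.pt] := by decide
example : eWord 3 ![Sym.pt, Sym.h, Sym.one] = ![Sym.pt, Sym.h, Sym.one, Sym.e] := by decide

/-- (A1).1 kills every |E| = 1 word at EVERY (A1) assignment — no symmetry of the assignment is assumed. -/
theorem Tfun_eWord_eq_zero {U : Finset Cell} {gN gP : Cell → ℕ} (h1 : A1fun U gN gP) (f : Fin 4) {ψ : Fin 3 → Sym}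
    (hψ : ∀ j, (ψ j).efree = true) : Tfun U gN gP (eWord f ψ) = 0 :=
  h1.1 _ (eWord_not_efree f ψ) (eWord_ne_eeee f hψ) (eWord_ne_EEEE f ψ)

/-- the passive letters of the cell `c` seen from the active slot `f`, in increasing slot order. -/
def pass (f : Fin 4) (c : Cell) : Fin 3 → Letter := fun j => c (f.succAbove j)

/-- the PASSIVE COEFFICIENT of the filling `φ` on a letter triple `L`: the sum over the `3! = 6` placements `π` of `∏_j coef (φ (π j)) (L j)`
(for a filling with repeated symbols every distinct placement is counted `|Stab_{S₃} φ|` times — a harmless positive factor on a `= 0` row). -/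
def V3 (φ : Fin 3 → Sym) (L : Fin 3 → Letter) : GaussianInt :=
  ∑ π : Equiv.Perm (Fin 3), ∏ j : Fin 3, (φ (π j)).coef (L j)

/-- the **S₄-ORBIT SUM** of the |E| = 1 row `e ⊗ φ`: all 4 active slots × all 6 placements of `φ` on the passive slots. -/
def orbitRowE1 (U : Finset Cell) (gN gP : Cell → ℕ) (φ : Fin 3 → Sym) : GaussianInt :=
  ∑ f : Fin 4, ∑ π : Equiv.Perm (Fin 3), Tfun U gN gP (eWord f (fun j => φ (π j)))

/-- **VALIDITY: the orbit-summed |E| = 1 row vanishes at EVERY (A1) assignment** (each summand is an (A1).1 row; no symmetrisation). -/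
theorem orbitRowE1_eq_zero {U : Finset Cell} {gN gP : Cell → ℕ} (h1 : A1fun U gN gP) {φ : Fin 3 → Sym}
    (hφ : ∀ j, (φ j).efree = true) : orbitRowE1 U gN gP φ = 0 :=
  Finset.sum_eq_zero fun f _ => Finset.sum_eq_zero fun π _ => Tfun_eWord_eq_zero h1 f fun j => hφ (π j)

/-- the cell coefficient of an |E| = 1 word FACTORS: `conj β` of the active letter × the passive product. -/
theorem cellCoef_eWord (c : Cell) (f : Fin 4) (ψ : Fin 3 → Sym) :
    cellCoef c (eWord f ψ) = star (c f).beta * ∏ j : Fin 3, (ψ j).coef (c (f.succAbove j)) := by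
  unfold cellCoef
  rw [Fin.prod_univ_succAbove _ f, eWord_self]
  simp only [eWord_succAbove]
  rfl

theorem Tfun_eWord (U : Finset Cell) (gN gP : Cell → ℕ) (f : Fin 4) (ψ : Fin 3 → Sym) :
    Tfun U gN gP (eWord f ψ) =
      ∑ c ∈ U, ((gN c : GaussianInt) - gP c) * (star (c f).beta * ∏ j : Fin 3, (ψ j).coef (c (f.succAbove j))) := by
  unfold Tfun
  rw [← Finset.sum_sub_distrib]
  refine Finset.sum_congr rfl fun c _ => ?_
  rw [cellCoef_eWord]; ring

/-- **INCIDENCE FORM:** the orbit row is the sum over incidences `(c, f)` (cell, active slot) of the signed multiplicity times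
`conj β(c f) · V3 φ (passive letters of c at f)`. -/
theorem orbitRowE1_eq_incidence (U : Finset Cell) (gN gP : Cell → ℕ) (φ : Fin 3 → Sym) :
    orbitRowE1 U gN gP φ = ∑ c ∈ U, ((gN c : GaussianInt) - gP c) * ∑ f : Fin 4, star (c f).beta * V3 φ (pass f c) := by
  unfold orbitRowE1 V3 pass
  simp only [Tfun_eWord, Finset.mul_sum]
  exact (Finset.sum_congr rfl fun f _ => Finset.sum_comm).trans Finset.sum_comm

/-! ### §7.2 the passive coefficient is a SYMMETRIC function of the passive PROFILES `(a, n)` -/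

/-- the profile `(a, n)` of a letter: all that an e-free symbol sees (`coef 1 = 1`, `coef h = a`, `coef pt = n = a² − |β|²`). -/
def prof (ℓ : Letter) : ℤ × ℤ := (ℓ.a, ℓ.selfInt)

theorem coef_congr_prof {s : Sym} (hs : s.efree = true) {ℓ ℓ' : Letter} (h : prof ℓ = prof ℓ') : s.coef ℓ = s.coef ℓ' := by
  have ha : ℓ.a = ℓ'.a := congrArg Prod.fst h
  have hn : ℓ.selfInt = ℓ'.selfInt := congrArg Prod.snd h
  cases s with
  | one => rfl
  | h => simp only [Sym.coef, ha]
  | pt => simp only [Sym.coef, hn]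
  | e => exact absurd hs (by decide)
  | ebar => exact absurd hs (by decide)

/-- `V3 φ` depends on the passive letters only through their profiles. -/
theorem V3_congr_prof {φ : Fin 3 → Sym} (hφ : ∀ j, (φ j).efree = true) {L L' : Fin 3 → Letter}
    (h : ∀ j, prof (L j) = prof (L' j)) : V3 φ L = V3 φ L' :=
  Finset.sum_congr rfl fun π _ => Finset.prod_congr rfl fun j _ => coef_congr_prof (hφ (π j)) (h j)

/-- `V3 φ` is SYMMETRIC: permuting the passive letters re-indexes the placements. -/
theorem V3_perm (φ : Fin 3 → Sym) (L : Fin 3 → Letter) (ρ : Equiv.Perm (Fin 3)) :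
    V3 φ (fun j => L (ρ j)) = V3 φ L := by
  unfold V3
  have step : ∀ π : Equiv.Perm (Fin 3),
      ∏ j : Fin 3, (φ (π j)).coef (L (ρ j)) = ∏ j : Fin 3, (φ ((π * ρ⁻¹) j)).coef (L j) := fun π =>
    Fintype.prod_equiv ρ _ _ fun j => by rw [Equiv.Perm.mul_apply, Equiv.Perm.inv_def, Equiv.symm_apply_apply]
  simp_rw [step]
  exact Fintype.sum_equiv (Equiv.mulRight ρ⁻¹) _ _ fun π => rfl

/-! ### §7.3 bookkeeping: tuples with the same multiset of values differ by a permutation -/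

theorem exists_perm_of_ofFn_perm {α : Type*} : ∀ {n : ℕ} (P Q : Fin n → α), (List.ofFn P).Perm (List.ofFn Q) →
    ∃ σ : Equiv.Perm (Fin n), ∀ k, Q k = P (σ k)
  | 0, _, _, _ => ⟨1, fun k => k.elim0⟩
  | n + 1, P, Q, h => by
    have hmem : Q 0 ∈ List.ofFn P := h.mem_iff.mpr (by rw [List.ofFn_succ]; exact List.mem_cons_self)
    obtain ⟨i, hi⟩ := List.mem_ofFn.mp hmem
    have h' : (List.ofFn (fun k => P (Equiv.swap 0 i k))).Perm (List.ofFn Q) :=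
      (Equiv.Perm.ofFn_comp_perm (Equiv.swap 0 i) P).trans h
    rw [List.ofFn_succ, List.ofFn_succ, Equiv.swap_apply_left, hi] at h'
    obtain ⟨σ', hσ'⟩ :=
      exists_perm_of_ofFn_perm (fun k : Fin n => P (Equiv.swap 0 i k.succ)) (fun k => Q k.succ) (List.Perm.cons_inv h')
    refine ⟨Equiv.Perm.decomposeFin.symm (i, σ'), fun k => ?_⟩
    rcases Fin.eq_zero_or_eq_succ k with rfl | ⟨x, rfl⟩
    · rw [Equiv.Perm.decomposeFin_symm_apply_zero, hi]
    · rw [Equiv.Perm.decomposeFin_symm_apply_succ, hσ' x]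

theorem exists_perm_of_map_univ_eq {α : Type*} {n : ℕ} {P Q : Fin n → α}
    (h : (Finset.univ : Finset (Fin n)).val.map P = (Finset.univ : Finset (Fin n)).val.map Q) :
    ∃ σ : Equiv.Perm (Fin n), ∀ k, Q k = P (σ k) :=
  exists_perm_of_ofFn_perm P Q (Multiset.coe_eq_coe.mp (by simpa only [Fin.univ_val_map] using h))

/-! ### §7.4 LETTER MARGINALS `y[τ, σ, ℓ]` and the orbit row as a row on them (R19.527 (1)(a)) -/

/-- the SHAPE `(a; p, q)`, `p = max(|x|, |y|) ≥ q = min(|x|, |y|)`, of a letter — the invariant of its 8 placements. -/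
def shape (ℓ : Letter) : ℤ × ℤ × ℤ := (ℓ.a, max |ℓ.x| |ℓ.y|, min |ℓ.x| |ℓ.y|)

theorem selfInt_eq_of_shape (m : Letter) : m.selfInt = m.a ^ 2 - ((max |m.x| |m.y|) ^ 2 + (min |m.x| |m.y|) ^ 2) := by
  simp only [Letter.selfInt, Letter.bnorm]
  rcases le_total |m.x| |m.y| with hle | hle
  · rw [max_eq_right hle, min_eq_left hle, sq_abs, sq_abs]; ring
  · rw [max_eq_left hle, min_eq_right hle, sq_abs, sq_abs]

/-- the shape determines the profile. -/
theorem prof_eq_of_shape_eq {ℓ ℓ' : Letter} (h : shape ℓ = shape ℓ') : prof ℓ = prof ℓ' := by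
  simp only [shape, Prod.mk.injEq] at h
  obtain ⟨ha, hp, hq⟩ := h
  simp only [prof, Prod.mk.injEq]
  exact ⟨ha, by rw [selfInt_eq_of_shape ℓ, selfInt_eq_of_shape ℓ', ha, hp, hq]⟩

/-- the SHAPE MULTISET (multiset type `τ`) of a cell. -/
def shapeMS (c : Cell) : Multiset (ℤ × ℤ × ℤ) := (Finset.univ : Finset (Fin 4)).val.map fun g => shape (c g)

/-- removing the active slot: `τ = shape (c f) ::ₘ {shapes of the passive letters}`. -/
theorem shapeMS_eq_cons (c : Cell) (f : Fin 4) :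
    shapeMS c = shape (c f) ::ₘ (Finset.univ : Finset (Fin 3)).val.map (fun j => shape (pass f c j)) := by
  unfold shapeMS pass
  rw [Fin.univ_succAbove 3 f, Finset.cons_val, Multiset.map_cons, Finset.map_val, Multiset.map_map]
  rfl

/-- the KEY of an incidence `(c, f)` (cell, active slot): the active LETTER `ℓ = c f` and the multiset type `τ` of the cell —
CIBB-1.5's index `[τ, σ, ℓ]` (`σ = shape ℓ` is determined by `ℓ`). -/
def key (p : Cell × Fin 4) : Letter × Multiset (ℤ × ℤ × ℤ) := (p.1 p.2, shapeMS p.1)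

/-- two incidences with the same key have passive triples with the same PROFILES up to a placement. -/
theorem pass_prof_perm_of_key_eq {c c' : Cell} {f f' : Fin 4} (h : key (c, f) = key (c', f')) :
    ∃ σ : Equiv.Perm (Fin 3), ∀ j, prof (pass f' c' j) = prof (pass f c (σ j)) := by
  simp only [key, Prod.mk.injEq] at h
  obtain ⟨hℓ, hτ⟩ := h
  rw [shapeMS_eq_cons c f, shapeMS_eq_cons c' f', hℓ, Multiset.cons_inj_right] at hτ
  obtain ⟨σ, hσ⟩ := exists_perm_of_map_univ_eq hτ
  exact ⟨σ, fun j => prof_eq_of_shape_eq (hσ j)⟩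

/-- HENCE the incidence coefficient `conj β(ℓ) · V3 φ (passive letters)` depends on the incidence only through its key. -/
theorem incidenceCoef_eq_of_key_eq {φ : Fin 3 → Sym} (hφ : ∀ j, (φ j).efree = true) {c c' : Cell} {f f' : Fin 4}
    (h : key (c, f) = key (c', f')) :
    star (c f).beta * V3 φ (pass f c) = star (c' f').beta * V3 φ (pass f' c') := by
  have hℓ : c f = c' f' := congrArg Prod.fst h
  obtain ⟨σ, hσ⟩ := pass_prof_perm_of_key_eq h
  rw [hℓ, V3_congr_prof (L' := fun j => pass f c (σ j)) hφ hσ, V3_perm]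

variable (U : Finset Cell)

/-- the INCIDENCES of `U`: (cell of `U`, active slot). -/
def incid : Finset (Cell × Fin 4) := U ×ˢ (Finset.univ : Finset (Fin 4))

/-- the keys `[τ, σ, ℓ]` present on `U`. -/
def keys : Finset (Letter × Multiset (ℤ × ℤ × ℤ)) := (incid U).image key

/-- the LETTER MARGINAL `y_g[τ, σ, ℓ]` of a weight `g : Cell → ℕ` at the key `k = (ℓ, τ)`: the number, counted with multiplicity `g`, of
incidences `(c, f)`, `c ∈ U`, with active letter `c f = ℓ` and multiset type `τ` (so `Σ_ℓ y_g[τ, shape ℓ, ℓ] = mult_τ(σ) · x_τ`). -/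
def marg (g : Cell → ℕ) (k : Letter × Multiset (ℤ × ℤ × ℤ)) : ℕ := ∑ p ∈ (incid U).filter (fun p => key p = k), g p.1

open scoped Classical in
/-- the COEFFICIENT TABLE of the orbit row on keys: `conj β(ℓ) · V3 φ (any passive triple realising the key)` — independent of the
realisation by `incidenceCoef_eq_of_key_eq` (`keyCoef_key`). -/
noncomputable def keyCoef (φ : Fin 3 → Sym) (k : Letter × Multiset (ℤ × ℤ × ℤ)) : GaussianInt :=
  if h : ∃ p : Cell × Fin 4, key p = k then star (h.choose.1 h.choose.2).beta * V3 φ (pass h.choose.2 h.choose.1) else 0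

theorem keyCoef_key {φ : Fin 3 → Sym} (hφ : ∀ j, (φ j).efree = true) (c : Cell) (f : Fin 4) :
    keyCoef φ (key (c, f)) = star (c f).beta * V3 φ (pass f c) := by
  have h : ∃ p : Cell × Fin 4, key p = key (c, f) := ⟨(c, f), rfl⟩
  rw [keyCoef, dif_pos h]
  have hk : key (h.choose.1, h.choose.2) = key (c, f) := h.choose_spec
  exact incidenceCoef_eq_of_key_eq hφ hk

theorem exists_pos_of_one_le_sum' {ι : Type*} {S : Finset ι} {g : ι → ℕ} (h : 1 ≤ ∑ i ∈ S, g i) : ∃ a ∈ S, 0 < g a := by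
  obtain ⟨a, ha, hne⟩ := Finset.exists_ne_zero_of_sum_ne_zero (show ∑ i ∈ S, g i ≠ 0 by omega)
  exact ⟨a, ha, Nat.pos_of_ne_zero hne⟩

/-- generic MARGINALISATION: a sum over incidences whose coefficient factors through a key map is a sum over keys against marginals. -/
theorem sum_incid_eq_sum_keys {K : Type*} [DecidableEq K] (κ : Cell × Fin 4 → K) (C : K → GaussianInt) (g : Cell → ℕ) :
    ∑ p ∈ incid U, (g p.1 : GaussianInt) * C (κ p) =
      ∑ k ∈ (incid U).image κ, C k * ∑ p ∈ (incid U).filter (fun p => κ p = k), (g p.1 : GaussianInt) := by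
  rw [← Finset.sum_fiberwise_of_maps_to (fun p hp => Finset.mem_image_of_mem κ hp)]
  refine Finset.sum_congr rfl fun k _ => ?_
  rw [Finset.mul_sum]
  refine Finset.sum_congr rfl fun p hp => ?_
  rw [(Finset.mem_filter.mp hp).2]; ring

/-- **(a) THE ORBIT-SUMMED |E| = 1 ROW IS A ROW ON LETTER MARGINALS:** for every assignment `(gN, gP)` on `U` and every e-free filling `φ`,
`orbitRowE1 = Σ_{k = [τ,σ,ℓ]} keyCoef φ k · (y_N[k] − y_P[k])` with `keyCoef φ [τ,σ,ℓ] = conj β(ℓ) · V3 φ (τ ∖ σ)`. -/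
theorem orbitRowE1_eq_marginal (gN gP : Cell → ℕ) {φ : Fin 3 → Sym} (hφ : ∀ j, (φ j).efree = true) :
    orbitRowE1 U gN gP φ = ∑ k ∈ keys U, keyCoef φ k * ((marg U gN k : GaussianInt) - (marg U gP k : GaussianInt)) := by
  rw [orbitRowE1_eq_incidence]
  have hinc : ∀ g : Cell → ℕ, ∑ c ∈ U, (g c : GaussianInt) * ∑ f : Fin 4, star (c f).beta * V3 φ (pass f c)
      = ∑ k ∈ keys U, keyCoef φ k * (marg U g k : GaussianInt) := by
    intro g
    calc ∑ c ∈ U, (g c : GaussianInt) * ∑ f : Fin 4, star (c f).beta * V3 φ (pass f c)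
        = ∑ p ∈ incid U, (g p.1 : GaussianInt) * keyCoef φ (key p) := by
          rw [incid, Finset.sum_product]
          refine Finset.sum_congr rfl fun c _ => ?_
          rw [Finset.mul_sum]
          refine Finset.sum_congr rfl fun f _ => ?_
          rw [keyCoef_key hφ]
      _ = ∑ k ∈ keys U, keyCoef φ k * (marg U g k : GaussianInt) := by
          rw [keys, sum_incid_eq_sum_keys U key (keyCoef φ) g]
          refine Finset.sum_congr rfl fun k _ => ?_
          rw [marg, Nat.cast_sum]
  have hsplit : ∑ c ∈ U, ((gN c : GaussianInt) - gP c) * ∑ f : Fin 4, star (c f).beta * V3 φ (pass f c)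
      = (∑ c ∈ U, (gN c : GaussianInt) * ∑ f : Fin 4, star (c f).beta * V3 φ (pass f c))
        - ∑ c ∈ U, (gP c : GaussianInt) * ∑ f : Fin 4, star (c f).beta * V3 φ (pass f c) := by
    rw [← Finset.sum_sub_distrib]; exact Finset.sum_congr rfl fun c _ => by ring
  rw [hsplit, hinc gN, hinc gP, ← Finset.sum_sub_distrib]
  exact Finset.sum_congr rfl fun k _ => by ring

/-- **SOUNDNESS SENTENCE (R19.527 (1)(a)) — the row CIBB-1.5's PREREG cites:** at EVERY (A1) assignment `(gN, gP)` on any finite cell set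
`U` (integer multiplicities, NO symmetry assumed) and for every e-free passive filling `φ`, the orbit-summed |E| = 1 row holds on the letter
marginals: `Σ_{[τ,σ,ℓ]} conj β(ℓ) · V3 φ (τ ∖ σ) · (y_N[τ,σ,ℓ] − y_P[τ,σ,ℓ]) = 0`. -/
theorem orbitRowE1_marginal_sound {U : Finset Cell} {gN gP : Cell → ℕ} (h1 : A1fun U gN gP) {φ : Fin 3 → Sym}
    (hφ : ∀ j, (φ j).efree = true) :
    ∑ k ∈ keys U, keyCoef φ k * ((marg U gN k : GaussianInt) - (marg U gP k : GaussianInt)) = 0 := by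
  rw [← orbitRowE1_eq_marginal U gN gP hφ]; exact orbitRowE1_eq_zero h1 hφ

/-! ### §7.5 the PER-LETTER COVER LAW = L1 at level 1.5 (R19.527 (1)(b)) -/

/-- **generic LETTER-LEVEL COVER ROWS:** for ANY key map `κ` on incidences and ANY relation `R` on keys that shadows `Live` slot by slot,
every (A4) assignment satisfies: a key with N-marginal `≥ 1` has P-marginal mass `≥ 1` on the keys `R`-below it; dually for P. -/
theorem letterCoverRows_of_A4fun {K : Type*} [DecidableEq K] (κ : Cell × Fin 4 → K) (R : K → K → Prop) [∀ a b, Decidable (R a b)]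
    (hR : ∀ x y : Cell, Live x y → ∀ f : Fin 4, R (κ (x, f)) (κ (y, f))) {U : Finset Cell} {gN gP : Cell → ℕ}
    (h4 : A4fun U gN gP) :
    (∀ k ∈ (incid U).image κ, 1 ≤ ∑ p ∈ (incid U).filter (fun p => κ p = k), gN p.1 →
        1 ≤ ∑ k' ∈ ((incid U).image κ).filter (fun k' => R k' k), ∑ p ∈ (incid U).filter (fun p => κ p = k'), gP p.1) ∧
    (∀ k ∈ (incid U).image κ, 1 ≤ ∑ p ∈ (incid U).filter (fun p => κ p = k), gP p.1 →
        1 ≤ ∑ k' ∈ ((incid U).image κ).filter (fun k' => R k k'), ∑ p ∈ (incid U).filter (fun p => κ p = k'), gN p.1) := by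
  constructor
  · intro k _ hpos
    obtain ⟨p, hp, hgp⟩ := exists_pos_of_one_le_sum' hpos
    obtain ⟨hpU, hpk⟩ := Finset.mem_filter.mp hp
    have hyU : p.1 ∈ U := (Finset.mem_product.mp hpU).1
    obtain ⟨x, hxU, hxpos, hlive⟩ := h4.2 p.1 hyU hgp
    have hxinc : (x, p.2) ∈ incid U := Finset.mem_product.mpr ⟨hxU, Finset.mem_univ _⟩
    have hk' : κ (x, p.2) ∈ ((incid U).image κ).filter (fun k' => R k' k) :=
      Finset.mem_filter.mpr ⟨Finset.mem_image_of_mem κ hxinc, by rw [← hpk]; exact hR x p.1 hlive p.2⟩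
    calc 1 ≤ ∑ q ∈ (incid U).filter (fun q => κ q = κ (x, p.2)), gP q.1 :=
          le_trans (Nat.succ_le_of_lt hxpos) (Finset.single_le_sum (f := fun q : Cell × Fin 4 => gP q.1)
            (fun q _ => Nat.zero_le _)
            (show (x, p.2) ∈ (incid U).filter (fun q => κ q = κ (x, p.2)) from Finset.mem_filter.mpr ⟨hxinc, rfl⟩))
      _ ≤ _ := Finset.single_le_sum (f := fun k' => ∑ q ∈ (incid U).filter (fun q => κ q = k'), gP q.1)
            (fun k' _ => Nat.zero_le _) hk'
  · intro k _ hpos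
    obtain ⟨p, hp, hgp⟩ := exists_pos_of_one_le_sum' hpos
    obtain ⟨hpU, hpk⟩ := Finset.mem_filter.mp hp
    have hxU : p.1 ∈ U := (Finset.mem_product.mp hpU).1
    obtain ⟨y, hyU, hypos, hlive⟩ := h4.1 p.1 hxU hgp
    have hyinc : (y, p.2) ∈ incid U := Finset.mem_product.mpr ⟨hyU, Finset.mem_univ _⟩
    have hk' : κ (y, p.2) ∈ ((incid U).image κ).filter (fun k' => R k k') :=
      Finset.mem_filter.mpr ⟨Finset.mem_image_of_mem κ hyinc, by rw [← hpk]; exact hR p.1 y hlive p.2⟩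
    calc 1 ≤ ∑ q ∈ (incid U).filter (fun q => κ q = κ (y, p.2)), gN q.1 :=
          le_trans (Nat.succ_le_of_lt hypos) (Finset.single_le_sum (f := fun q : Cell × Fin 4 => gN q.1)
            (fun q _ => Nat.zero_le _)
            (show (y, p.2) ∈ (incid U).filter (fun q => κ q = κ (y, p.2)) from Finset.mem_filter.mpr ⟨hyinc, rfl⟩))
      _ ≤ _ := Finset.single_le_sum (f := fun k' => ∑ q ∈ (incid U).filter (fun q => κ q = k'), gN q.1)
            (fun k' _ => Nat.zero_le _) hk'

/-- **(b) `coverRowsLetter_of_A4fun` — L1 AT LEVEL 1.5 on the marginals `y[τ,σ,ℓ]`:** at every (A4) assignment,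
`y_N[τ,σ,ℓ] ≥ 1 ⇒ Σ_{[τ',σ',ℓ'] : ℓ' amply below ℓ} y_P[τ',σ',ℓ'] ≥ 1`, and `y_P[τ,σ,ℓ] ≥ 1 ⇒ Σ_{ℓ' amply above ℓ} y_N ≥ 1`. -/
theorem coverRowsLetter_of_A4fun {U : Finset Cell} {gN gP : Cell → ℕ} (h4 : A4fun U gN gP) :
    (∀ k ∈ keys U, 1 ≤ marg U gN k → 1 ≤ ∑ k' ∈ (keys U).filter (fun k' => AmpleAbove k'.1 k.1), marg U gP k') ∧
    (∀ k ∈ keys U, 1 ≤ marg U gP k → 1 ≤ ∑ k' ∈ (keys U).filter (fun k' => AmpleAbove k.1 k'.1), marg U gN k') :=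
  letterCoverRows_of_A4fun key (fun k' k => AmpleAbove k'.1 k.1) (fun _ _ h f => h f) h4

/-- `π ∈ Cov(τ)` (CIBB-1.5): the multiset types are realised by a pair of cells in the shape-multiset shadow `⊲_S` (`MultisetBelow`). -/
def CovMS (m' m : Multiset (ℤ × ℤ × ℤ)) : Prop := ∃ x y : Cell, shapeMS x = m' ∧ shapeMS y = m ∧ MultisetBelow x y

open scoped Classical in
/-- **(b′) the (Dy) rows of CIBB-1.5 exactly:** `y_N[τ,σ,ℓ] ≥ 1 ⇒ Σ { y_P[π,σ',ℓ'] : π ∈ Cov(τ), ℓ' amply below ℓ } ≥ 1`, and dually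
(`π` co-covering `τ`, `ℓ'` amply above `ℓ`) — at every (A4) assignment, from (A4) + «present ⇒ mass ≥ 1». -/
theorem coverRowsLetterCov_of_A4fun {U : Finset Cell} {gN gP : Cell → ℕ} (h4 : A4fun U gN gP) :
    (∀ k ∈ keys U, 1 ≤ marg U gN k →
        1 ≤ ∑ k' ∈ (keys U).filter (fun k' => AmpleAbove k'.1 k.1 ∧ CovMS k'.2 k.2), marg U gP k') ∧
    (∀ k ∈ keys U, 1 ≤ marg U gP k →
        1 ≤ ∑ k' ∈ (keys U).filter (fun k' => AmpleAbove k.1 k'.1 ∧ CovMS k.2 k'.2), marg U gN k') :=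
  letterCoverRows_of_A4fun key (fun k' k => AmpleAbove k'.1 k.1 ∧ CovMS k'.2 k.2)
    (fun x y h f => ⟨h f, x, y, rfl, rfl, multisetBelow_of_live h⟩) h4

/-- **`coverClosedLetter_of_A4`** (support form, beside `coverClosed_of_A4`): in an (A4) design every present N cell `y` has, for EVERY slot
`f`, a present P cell whose letter at the SAME slot is amply below `y f` and whose multiset type lies in the `⊲_S`-shadow of `y`'s (indeed one
slotwise amply below `y`); dually for P cells. The per-letter cover disjunction (Dy) read on supports. -/
theorem coverClosedLetter_of_A4 {D : Design} (h4 : D.A4) :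
    (∀ y ∈ D.suppN, ∀ f : Fin 4, ∃ x ∈ D.suppP, AmpleAbove (x f) (y f) ∧ MultisetBelow x y) ∧
    (∀ x ∈ D.suppP, ∀ f : Fin 4, ∃ y ∈ D.suppN, AmpleAbove (x f) (y f) ∧ MultisetBelow x y) :=
  ⟨fun y hy f => by
    obtain ⟨x, hx, hl⟩ := h4.2 y hy
    exact ⟨x, hx, hl f, multisetBelow_of_live hl⟩,
   fun x hx f => by
    obtain ⟨y, hy, hl⟩ := h4.1 x hx
    exact ⟨y, hy, hl f, multisetBelow_of_live hl⟩⟩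

end level15

end Summit.HodgeConjecture.HodgeConjecture.Cruxes.BlochSeedDiscOne.CoverIntegrality
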